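import Literature.Analysis.FluidPDE.EulerGalerkinNorms
import Literature.Analysis.FluidPDE.EulerGalerkinLeibniz
import Literature.Analysis.FluidPDE.FracNSGalerkinExistence
import HarnessLib

/-!
# Smooth short-time solutions by the Fourier–Galerkin energy method, I: uniform `H^m` bounds for
# the damped Galerkin system on `T^d`

Analysis/FluidPDE proof file (theorems only; no definitions, no named facts). First part of a
proof of **short-time existence of smooth solutions** for the incompressible systems
`∂ₜv + (v·∇)v + ∇p + νΔ-type dissipation = 0`, `div v = 0` on the flat torus by the classical
energy method (A. J. Majda, A. L. Bertozzi, *Vorticity and Incompressible Flow*, CUP 2002, §3.2: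
Thm. 3.4 "Local-in-Time Existence of Solutions to the Euler and the Navier–Stokes equations",
Prop. 3.7 (the `H^m` energy estimate), Thm. 3.5 and (3.79) (continuation as long as a low norm is
controlled); Robinson–Rodrigo–Sadowski 2016, §4.1, Thm. 4.4 for the Fourier–Galerkin scheme on the
torus). The dissipation is kept **general**: viscosity `ν ≥ 0` (the tree's `Torus.galerkinField ν`)
plus a force `g k = -σ(k) c k` with an arbitrary nonnegative even symbol `σ` — `σ = 0` is the Euler
system (the open fact `Torus.eulerSmoothShortTime`, `EulerTorusLocalExistence.lean`),
`σ = ν'(4π²|k|²)^γ` the fractional Navier–Stokes system of L. De Rosa, *Infinitely many Leray–Hopf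
solutions for the fractional Navier–Stokes equations*, Comm. PDE 44 (2019) = arXiv:1801.10235,
§3.2, Thm. 3.4 ("For a proof … we refer to [MaBe2002] (Theorem 3.4 in Chapter 3) … The proof uses
the so called "energy method" and it can be easily adapted to any power `γ` of the Laplacian"),
which is the input (Cor. 5.2) of the gluing stage of De Rosa's convex-integration scheme
(`DeRosa.gluingStage`, `DeRosaThreeStages.lean`). All bounds below are **uniform in the truncation
`S`, in `ν ≥ 0` and in `σ ≥ 0`** (the dissipative terms have a sign and are dropped).

## Contents (all proved)

* Calculus of real trigonometric polynomials `u = realTrigPoly S c` on the Fourier side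
  (building on `EulerGalerkinNorms`, `EulerGalerkinLeibniz`): mixed derivatives
  `∂ⱼ∂ᵢᵇu` as polynomials, `L²` and sup bounds of `∂ᵢᵃu`, `∂ⱼ∂ᵢᵇu` through the Sobolev sums
  `W_s = ∑_{k∈S} (1+|k|²)ˢ ‖c k‖²` and the embedding constant `B ≥ ∑_{k∈S} ((1+|k|²)²)⁻¹`
  (finite on all of `ℤ^d` for `d ≤ 3`).
* `abs_commutatorTerm_le`, `abs_integral_inner_iterate_convect_le` — **the commutator estimate**
  of Prop. 3.7 for pure derivatives: `|∫ ⟪∂ᵢᵐ[(u·∇)u], ∂ᵢᵐu⟫| ≤ 2ᵐ #d √B (2π)^{2m+1} √W_r W_m`,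
  `r = max 4 (m-1)`, `m ≥ 4` (Leibniz, cancellation of the top term for `div u = 0`, `H² ⊂ L^∞`
  on the lower factor; cubic at `m = 4`, linear in `W_m` given `W_{m-1}` for `m ≥ 5`).
* `sum_weight_re_inner_galerkinRHS`, `weightedPairing_le`, `energyPairing_le`, `purePairing_le` —
  the weighted energy identities of the damped Galerkin field
  `V(-σc, c)_k = -ν4π²|k|² c_k + Π_k(-σ_k c_k - 𝓕[(u·∇)u](k))` (the Leray multiplier and the
  truncation are invisible against `∂ᵢ^{2m}u`; Stokes and damping terms are `≤ 0`).
* `pureEnergy_four_le` — **the short-time `H⁴` bound** (Thm. 3.4 (ii), (3.56), `m = 4`): with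
  `P = ∑_k (1 + ∑ᵢ(2π|kᵢ|)⁸)‖β k‖²`, `P(0) ≤ P₁` and `T (L+1)√P₁ ≤ 1` (explicit `L = L(d, B)`),
  `P(t) ≤ 4P₁` on `[0,T]` (comparison with `P₁(1 - (L+1)√P₁t/2)⁻²`).
* `pureEnergy_le_exp` — linear Grönwall propagation of `P_m` given a bound on `W_{max 4 (m-1)}`.
* `sobolev_bounds_allOrders` — **uniform bounds of all orders `m ≥ 4` on the `H⁴` life span**
  `T c(d,B) √M ≤ 1`, `W₄(0) ≤ M`: `W_m(t) ≤ Φ_m(M, W_m(0))` with `Φ_m` independent of `S, ν, σ`.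
* `exists_dampedGalerkin_solution` — global solutions of the damped Galerkin ODE in the real
  divergence-free phase space (energy monotonicity + `ODE.exists_solution_of_apriori_bound`),
  generalising the tree's `exists_fracGalerkin_solution` (`σ = (4π²|k|²)^α`, `ν = 0`).

The sequel files take the limit `S = freqBall n`, `n → ∞` (Cauchy property in `L²`, limit
coefficients, time regularity, synthesis of a jointly smooth solution on the closed time slab).

## Mathlib / tree search

Tree: `Torus.galerkinField`, `galerkinRHS`, `galerkinSubspace`, master identities
(`NSGalerkinFourier`); `hasDerivWithinAt_sum_norm_sq`, `norm_galerkinRHS_sub_le`,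
`exists_fracGalerkin_solution` (`NSHopfGalerkinExistence`, `FracNSGalerkinExistence`);
`EulerGalerkinNorms` (Parseval/sup bounds for `∂ᵢʲ realTrigPoly`), `Torus.iterate_partialDeriv_convect`
(`EulerGalerkinLeibniz`); `integral_inner_convect_eq_neg` (`TorusFluidGlueProofs`). Mathlib:
`image_le_of_deriv_right_lt_deriv_boundary'`, `le_gronwallBound_of_liminf_deriv_right_le`,
`pow_sum_div_card_le_sum_pow` (Jensen for the weight comparison), `integral_mul_norm_le_Lp_mul_Lq`.

## References

* A. J. Majda, A. L. Bertozzi, *Vorticity and Incompressible Flow*, CUP 2002, §3.2: Thm. 3.4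
  (i)–(ii) with (3.55)–(3.56), Prop. 3.7, Thm. 3.5, (3.79). [`MajdaBertozziCUP2002`]
* J. C. Robinson, J. L. Rodrigo, W. Sadowski, *The three-dimensional Navier–Stokes equations*,
  CUP 2016, §4.1, Thm. 4.4 Steps 1–2, (4.5)–(4.7). [`RobinsonRodrigoSadowski2016`]
* L. De Rosa, Comm. PDE 44 (2019) 335–365 = arXiv:1801.10235, §3.2 Thm. 3.4, Prop. 3.5; §5.2
  Cor. 5.2. [`Derosa2018`]
* M. Colombo, C. De Lellis, L. De Rosa, Comm. Math. Phys. 362 (2018), §9 (the fractional Galerkin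
  system). [`ColomboDelellisDerosa2018`]
-/

noncomputable section

open MeasureTheory Set Filter Topology Function UnitAddTorus Metric
open scoped ENNReal NNReal InnerProductSpace ContDiff

namespace Literature.Analysis.FluidPDE

namespace GalerkinSmooth

open FunctionSpaces FunctionSpaces.Torus Torus EulerGalerkin

variable {d : Type*} [Fintype d] [DecidableEq d]

/-! ## Mixed derivatives of real trigonometric polynomials and their symbols -/

/-- `∂ⱼ ∂ᵢᵇ (realTrigPoly S c) = realTrigPoly S ((2πi kⱼ) • (2πi kᵢ)ᵇ • c)`. [folklore] -/
theorem partialDeriv_iterate_partialDeriv_realTrigPoly (S : Finset (d → ℤ))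
    (c : (d → ℤ) → EuclideanSpace ℂ d) (i j : d) (b : ℕ) :
    Torus.partialDeriv j ((Torus.partialDeriv i)^[b] (realTrigPoly S c)) =
      realTrigPoly S (fun k => (2 * Real.pi * Complex.I * (k j : ℂ)) •
        ((2 * Real.pi * Complex.I * (k i : ℂ)) ^ b • c k)) := by
  rw [iterate_partialDeriv_realTrigPoly, partialDeriv_realTrigPoly']

omit [DecidableEq d] in
/-- The size of the mixed symbol: `‖(2πi kⱼ) • (2πi kᵢ)ᵇ • z‖ = 2π|kⱼ| (2π|kᵢ|)ᵇ ‖z‖`. [folklore] -/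
theorem norm_mixedSymbol_smul (k : d → ℤ) (i j : d) (b : ℕ) (z : EuclideanSpace ℂ d) :
    ‖(2 * Real.pi * Complex.I * (k j : ℂ)) • ((2 * Real.pi * Complex.I * (k i : ℂ)) ^ b • z)‖ =
      (2 * Real.pi * |(k j : ℝ)|) * ((2 * Real.pi * |(k i : ℝ)|) ^ b * ‖z‖) := by
  have h1 := norm_derivSymbol_pow_smul k j 1 ((2 * Real.pi * Complex.I * (k i : ℂ)) ^ b • z)
  rw [pow_one, pow_one] at h1
  rw [h1, norm_derivSymbol_pow_smul]

omit [DecidableEq d] in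
/-- The squared mixed symbol is dominated by the Sobolev weight:
`(2π|kⱼ|)² (2π|kᵢ|)^{2b} ≤ (2π)^{2(b+1)} (1+|k|²)^{b+1}`. [folklore] -/
theorem mixedSymbol_sq_le (k : d → ℤ) (i j : d) (b : ℕ) :
    ((2 * Real.pi * |(k j : ℝ)|) * (2 * Real.pi * |(k i : ℝ)|) ^ b) ^ 2 ≤
      (2 * Real.pi) ^ (2 * (b + 1)) * (1 + freqNormSq k) ^ (b + 1) := by
  have h1 := derivSymbol_sq_pow_le k j 1
  have h2 := derivSymbol_sq_pow_le k i b
  rw [pow_one, mul_one, pow_one] at h1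
  have h0 : 0 ≤ ((2 * Real.pi * |(k i : ℝ)|) ^ b) ^ 2 := sq_nonneg _
  have h0' : 0 ≤ (2 * Real.pi) ^ 2 * (1 + freqNormSq k) := by
    have := freqNormSq_nonneg k; positivity
  calc ((2 * Real.pi * |(k j : ℝ)|) * (2 * Real.pi * |(k i : ℝ)|) ^ b) ^ 2
      = (2 * Real.pi * |(k j : ℝ)|) ^ 2 * ((2 * Real.pi * |(k i : ℝ)|) ^ b) ^ 2 := by ring
    _ ≤ ((2 * Real.pi) ^ 2 * (1 + freqNormSq k)) *
          ((2 * Real.pi) ^ (2 * b) * (1 + freqNormSq k) ^ b) :=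
        mul_le_mul h1 h2 h0 h0'
    _ = (2 * Real.pi) ^ (2 * (b + 1)) * (1 + freqNormSq k) ^ (b + 1) := by ring

/-! ## `L²` and sup bounds for symbol-dominated families -/

omit [DecidableEq d] in
/-- **`L²` bound**: if `‖c' k‖² ≤ M (1+|k|²)ʳ ‖c k‖²` on `S` then
`∫ ‖realTrigPoly S c'‖² ≤ M ∑_{k∈S} (1+|k|²)ʳ ‖c k‖²`. [folklore] -/
theorem integral_norm_sq_realTrigPoly_le_of_symbol {S : Finset (d → ℤ)} (hS : ∀ k ∈ S, -k ∈ S)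
    {c c' : (d → ℤ) → EuclideanSpace ℂ d} (hc' : IsConjSymm c') {M : ℝ} {r : ℕ}
    (h : ∀ k ∈ S, ‖c' k‖ ^ 2 ≤ M * ((1 + freqNormSq k) ^ r * ‖c k‖ ^ 2)) :
    ∫ x, ‖realTrigPoly S c' x‖ ^ 2 ≤ M * ∑ k ∈ S, (1 + freqNormSq k) ^ r * ‖c k‖ ^ 2 := by
  rw [integral_norm_sq_realTrigPoly hS hc', Finset.mul_sum]
  exact Finset.sum_le_sum h

omit [DecidableEq d] in
/-- **Sup bound** (`H² ⊂ L^∞` on the coefficient side): if `‖c' k‖² ≤ M (1+|k|²)ʳ ‖c k‖²` on `S`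
and `∑_{k∈S} ((1+|k|²)²)⁻¹ ≤ B` then
`‖realTrigPoly S c' x‖² ≤ B M ∑_{k∈S} (1+|k|²)^{r+2} ‖c k‖²`. [folklore] -/
theorem sq_norm_realTrigPoly_le_of_symbol {S : Finset (d → ℤ)}
    {c c' : (d → ℤ) → EuclideanSpace ℂ d} {M B : ℝ} {r : ℕ}
    (h : ∀ k ∈ S, ‖c' k‖ ^ 2 ≤ M * ((1 + freqNormSq k) ^ r * ‖c k‖ ^ 2))
    (hB : ∑ k ∈ S, ((1 + freqNormSq k) ^ 2)⁻¹ ≤ B) (x : UnitAddTorus d) :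
    ‖realTrigPoly S c' x‖ ^ 2 ≤ B * (M * ∑ k ∈ S, (1 + freqNormSq k) ^ (r + 2) * ‖c k‖ ^ 2) := by
  have hw : ∀ k : d → ℤ, 0 < 1 + freqNormSq k := fun k => by linarith [freqNormSq_nonneg k]
  have hle := norm_realTrigPoly_apply_le S c' x
  have h0 : 0 ≤ ∑ k ∈ S, ‖c' k‖ := Finset.sum_nonneg fun k _ => norm_nonneg _
  -- split each term as `(1+|k|²)⁻¹ · ((1+|k|²) ‖c' k‖)`
  have hsplit : ∀ k ∈ S, ‖c' k‖ = (1 + freqNormSq k)⁻¹ * ((1 + freqNormSq k) * ‖c' k‖) := by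
    intro k _
    rw [← mul_assoc, inv_mul_cancel₀ (hw k).ne', one_mul]
  have hCS : (∑ k ∈ S, ‖c' k‖) ^ 2 ≤
      (∑ k ∈ S, ((1 + freqNormSq k)⁻¹) ^ 2) * ∑ k ∈ S, ((1 + freqNormSq k) * ‖c' k‖) ^ 2 := by
    rw [Finset.sum_congr rfl hsplit]
    exact Finset.sum_mul_sq_le_sq_mul_sq S (fun k => (1 + freqNormSq k)⁻¹)
      (fun k => (1 + freqNormSq k) * ‖c' k‖)
  have h1 : ∑ k ∈ S, ((1 + freqNormSq k)⁻¹) ^ 2 ≤ B :=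
    le_trans (le_of_eq (Finset.sum_congr rfl fun k _ => by rw [inv_pow])) hB
  have h2 : ∑ k ∈ S, ((1 + freqNormSq k) * ‖c' k‖) ^ 2 ≤
      M * ∑ k ∈ S, (1 + freqNormSq k) ^ (r + 2) * ‖c k‖ ^ 2 := by
    rw [Finset.mul_sum]
    refine Finset.sum_le_sum fun k hk => ?_
    have hwk : 0 ≤ (1 + freqNormSq k) ^ 2 := sq_nonneg _
    calc ((1 + freqNormSq k) * ‖c' k‖) ^ 2 = (1 + freqNormSq k) ^ 2 * ‖c' k‖ ^ 2 := by ring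
      _ ≤ (1 + freqNormSq k) ^ 2 * (M * ((1 + freqNormSq k) ^ r * ‖c k‖ ^ 2)) :=
          mul_le_mul_of_nonneg_left (h k hk) hwk
      _ = M * ((1 + freqNormSq k) ^ (r + 2) * ‖c k‖ ^ 2) := by ring
  have h20 : 0 ≤ ∑ k ∈ S, ((1 + freqNormSq k) * ‖c' k‖) ^ 2 :=
    Finset.sum_nonneg fun k _ => sq_nonneg _
  calc ‖realTrigPoly S c' x‖ ^ 2 ≤ (∑ k ∈ S, ‖c' k‖) ^ 2 := pow_le_pow_left₀ (norm_nonneg _) hle 2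
    _ ≤ (∑ k ∈ S, ((1 + freqNormSq k)⁻¹) ^ 2) * ∑ k ∈ S, ((1 + freqNormSq k) * ‖c' k‖) ^ 2 := hCS
    _ ≤ B * ∑ k ∈ S, ((1 + freqNormSq k) * ‖c' k‖) ^ 2 := mul_le_mul_of_nonneg_right h1 h20
    _ ≤ B * (M * ∑ k ∈ S, (1 + freqNormSq k) ^ (r + 2) * ‖c k‖ ^ 2) :=
        mul_le_mul_of_nonneg_left h2 ((Finset.sum_nonneg fun k _ => sq_nonneg _).trans h1)

/-! ## The derivative families of a coefficient family -/

omit [DecidableEq d] in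
/-- The pure derivative family `(2πi kᵢ)ᵃ • c` is dominated with weight `(1+|k|²)ᵃ` and constant
`(2π)^{2a}`. [folklore] -/
theorem norm_sq_derivSymbol_smul_le (c : (d → ℤ) → EuclideanSpace ℂ d) (i : d) (a : ℕ)
    (k : d → ℤ) :
    ‖(2 * Real.pi * Complex.I * (k i : ℂ)) ^ a • c k‖ ^ 2 ≤
      (2 * Real.pi) ^ (2 * a) * ((1 + freqNormSq k) ^ a * ‖c k‖ ^ 2) := by
  rw [norm_derivSymbol_pow_smul, mul_pow, ← mul_assoc]
  exact mul_le_mul_of_nonneg_right (derivSymbol_sq_pow_le k i a) (sq_nonneg _)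

omit [DecidableEq d] in
/-- The mixed derivative family `(2πi kⱼ) • (2πi kᵢ)ᵇ • c` is dominated with weight
`(1+|k|²)^{b+1}` and constant `(2π)^{2(b+1)}`. [folklore] -/
theorem norm_sq_mixedSymbol_smul_le (c : (d → ℤ) → EuclideanSpace ℂ d) (i j : d) (b : ℕ)
    (k : d → ℤ) :
    ‖(2 * Real.pi * Complex.I * (k j : ℂ)) • ((2 * Real.pi * Complex.I * (k i : ℂ)) ^ b • c k)‖ ^ 2 ≤
      (2 * Real.pi) ^ (2 * (b + 1)) * ((1 + freqNormSq k) ^ (b + 1) * ‖c k‖ ^ 2) := by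
  rw [norm_mixedSymbol_smul, ← mul_assoc, mul_pow, ← mul_assoc]
  exact mul_le_mul_of_nonneg_right (mixedSymbol_sq_le k i j b) (sq_nonneg _)

omit [Fintype d] [DecidableEq d] in
/-- The mixed derivative family is conjugate symmetric. [folklore] -/
theorem _root_.Literature.Analysis.FunctionSpaces.Torus.IsConjSymm.mixedSymbol
    {c : (d → ℤ) → EuclideanSpace ℂ d} (hc : IsConjSymm c) (i j : d) (b : ℕ) :
    IsConjSymm (fun k : d → ℤ => (2 * Real.pi * Complex.I * (k j : ℂ)) •
      ((2 * Real.pi * Complex.I * (k i : ℂ)) ^ b • c k)) :=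
  (hc.iterate_deriv i b).deriv j

/-! ## Norms of derivatives of a real trigonometric polynomial through the Sobolev weights -/

section Norms

variable {S : Finset (d → ℤ)} {c : (d → ℤ) → EuclideanSpace ℂ d}

/-- `∫ ‖∂ᵢᵃ u‖² ≤ (2π)^{2a} W_a`, `W_a = ∑_{k∈S} (1+|k|²)ᵃ ‖c k‖²`: the tree's
`integral_norm_sq_iterate_partialDeriv_realTrigPoly_le` (`EulerGalerkinNorms.lean`), kept under this
file's short name. [folklore] -/
theorem integral_norm_sq_iterate_le (hS : ∀ k ∈ S, -k ∈ S) (hc : IsConjSymm c) (i : d) (a : ℕ) :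
    ∫ x, ‖(Torus.partialDeriv i)^[a] (realTrigPoly S c) x‖ ^ 2 ≤
      (2 * Real.pi) ^ (2 * a) * ∑ k ∈ S, (1 + freqNormSq k) ^ a * ‖c k‖ ^ 2 :=
  integral_norm_sq_iterate_partialDeriv_realTrigPoly_le hS hc i a

/-- `∫ ‖∂ⱼ∂ᵢᵇ u‖² ≤ (2π)^{2(b+1)} W_{b+1}`. [folklore] -/
theorem integral_norm_sq_mixed_le (hS : ∀ k ∈ S, -k ∈ S) (hc : IsConjSymm c) (i j : d) (b : ℕ) :
    ∫ x, ‖Torus.partialDeriv j ((Torus.partialDeriv i)^[b] (realTrigPoly S c)) x‖ ^ 2 ≤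
      (2 * Real.pi) ^ (2 * (b + 1)) * ∑ k ∈ S, (1 + freqNormSq k) ^ (b + 1) * ‖c k‖ ^ 2 := by
  rw [partialDeriv_iterate_partialDeriv_realTrigPoly]
  exact integral_norm_sq_realTrigPoly_le_of_symbol hS (hc.mixedSymbol i j b)
    fun k _ => norm_sq_mixedSymbol_smul_le c i j b k

/-- `‖∂ᵢᵃ u (x)‖² ≤ B (2π)^{2a} W_{a+2}`: the tree's `sq_norm_iterate_partialDeriv_realTrigPoly_le`
(`EulerGalerkinNorms.lean`), kept under this file's short name. [folklore] -/
theorem sq_norm_iterate_le {B : ℝ} (hB : ∑ k ∈ S, ((1 + freqNormSq k) ^ 2)⁻¹ ≤ B) (i : d) (a : ℕ)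
    (x : UnitAddTorus d) :
    ‖(Torus.partialDeriv i)^[a] (realTrigPoly S c) x‖ ^ 2 ≤
      B * ((2 * Real.pi) ^ (2 * a) * ∑ k ∈ S, (1 + freqNormSq k) ^ (a + 2) * ‖c k‖ ^ 2) :=
  sq_norm_iterate_partialDeriv_realTrigPoly_le c i a hB x

/-- `‖∂ⱼ∂ᵢᵇ u (x)‖² ≤ B (2π)^{2(b+1)} W_{b+3}`. [folklore] -/
theorem sq_norm_mixed_le {B : ℝ} (hB : ∑ k ∈ S, ((1 + freqNormSq k) ^ 2)⁻¹ ≤ B) (i j : d) (b : ℕ)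
    (x : UnitAddTorus d) :
    ‖Torus.partialDeriv j ((Torus.partialDeriv i)^[b] (realTrigPoly S c)) x‖ ^ 2 ≤
      B * ((2 * Real.pi) ^ (2 * (b + 1)) * ∑ k ∈ S, (1 + freqNormSq k) ^ (b + 1 + 2) * ‖c k‖ ^ 2) := by
  rw [partialDeriv_iterate_partialDeriv_realTrigPoly]
  exact sq_norm_realTrigPoly_le_of_symbol (fun k _ => norm_sq_mixedSymbol_smul_le c i j b k) hB x

end Norms

/-! ## Trilinear bounds in physical space -/

section Trilinear

variable {G : Type*} [NormedAddCommGroup G] [InnerProductSpace ℝ G]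

omit [DecidableEq d] in
/-- **Cauchy–Schwarz** for norms of smooth functions on `T^d`:
`∫ ‖f‖ ‖g‖ ≤ (∫ ‖f‖²)^{1/2} (∫ ‖g‖²)^{1/2}`. [folklore] -/
theorem integral_norm_mul_norm_le {G₁ G₂ : Type*} [NormedAddCommGroup G₁] [NormedSpace ℝ G₁]
    [NormedAddCommGroup G₂] [NormedSpace ℝ G₂] {f : UnitAddTorus d → G₁} {g : UnitAddTorus d → G₂}
    (hf : IsSmooth f) (hg : IsSmooth g) :
    ∫ x, ‖f x‖ * ‖g x‖ ≤ Real.sqrt (∫ x, ‖f x‖ ^ 2) * Real.sqrt (∫ x, ‖g x‖ ^ 2) := by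
  have h := integral_mul_norm_le_Lp_mul_Lq (μ := volume) (f := fun x => ‖f x‖) (g := fun x => ‖g x‖)
    Real.HolderConjugate.two_two (by simpa using (hf.memLp 2).norm) (by simpa using (hg.memLp 2).norm)
  simp only [norm_norm, Real.rpow_two, one_div, Real.sqrt_eq_rpow] at h ⊢
  exact h

/-- **Trilinear bound, sup norm on the transporting field**: for smooth `v, w, z` with
`‖v‖ ≤ V` pointwise,
`|∫ ⟪(v·∇)w, z⟫| ≤ V ∑ⱼ ‖∂ⱼw‖_{L²} ‖z‖_{L²}`. [folklore] -/
theorem abs_integral_inner_convect_le_of_sup_left {v : UnitAddTorus d → EuclideanSpace ℝ d}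
    {w z : UnitAddTorus d → G} (hw : IsSmooth w) (hz : IsSmooth z) {V : ℝ} (hV : ∀ x, ‖v x‖ ≤ V) :
    |∫ x, ⟪Torus.convect v w x, z x⟫_ℝ| ≤
      V * ∑ j, Real.sqrt (∫ x, ‖Torus.partialDeriv j w x‖ ^ 2) * Real.sqrt (∫ x, ‖z x‖ ^ 2) := by
  have hw1 : IsContDiff 1 w := hw.isContDiff (by simp)
  have hV0 : 0 ≤ V := (norm_nonneg _).trans (hV 0)
  have hpt : ∀ x, |⟪Torus.convect v w x, z x⟫_ℝ| ≤ V * ∑ j, ‖Torus.partialDeriv j w x‖ * ‖z x‖ := by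
    intro x
    have hs0 : 0 ≤ ∑ j, ‖Torus.partialDeriv j w x‖ := Finset.sum_nonneg fun j _ => norm_nonneg _
    calc |⟪Torus.convect v w x, z x⟫_ℝ| ≤ ‖Torus.convect v w x‖ * ‖z x‖ := abs_real_inner_le_norm _ _
      _ ≤ (‖v x‖ * ∑ j, ‖Torus.partialDeriv j w x‖) * ‖z x‖ :=
          mul_le_mul_of_nonneg_right (norm_convect_le v hw1 x) (norm_nonneg _)
      _ ≤ (V * ∑ j, ‖Torus.partialDeriv j w x‖) * ‖z x‖ :=
          mul_le_mul_of_nonneg_right (mul_le_mul_of_nonneg_right (hV x) hs0) (norm_nonneg _)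
      _ = V * ∑ j, ‖Torus.partialDeriv j w x‖ * ‖z x‖ := by rw [mul_assoc, Finset.sum_mul]
  have hint : ∀ j, Integrable (fun x => ‖Torus.partialDeriv j w x‖ * ‖z x‖) volume := fun j =>
    ((hw.partialDeriv j).continuous.norm.mul hz.continuous.norm).integrable_unitAddTorus
  calc |∫ x, ⟪Torus.convect v w x, z x⟫_ℝ| ≤ ∫ x, |⟪Torus.convect v w x, z x⟫_ℝ| := abs_integral_le_integral_abs
    _ ≤ ∫ x, V * ∑ j, ‖Torus.partialDeriv j w x‖ * ‖z x‖ := by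
        refine integral_mono_of_nonneg (Eventually.of_forall fun x => abs_nonneg _) ?_
          (Eventually.of_forall hpt)
        exact (integrable_finsetSum _ fun j _ => hint j).const_mul V
    _ = V * ∑ j, ∫ x, ‖Torus.partialDeriv j w x‖ * ‖z x‖ := by
        rw [integral_const_mul, integral_finsetSum _ fun j _ => hint j]
    _ ≤ V * ∑ j, Real.sqrt (∫ x, ‖Torus.partialDeriv j w x‖ ^ 2) * Real.sqrt (∫ x, ‖z x‖ ^ 2) := by
        refine mul_le_mul_of_nonneg_left (Finset.sum_le_sum fun j _ => ?_) hV0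
        exact integral_norm_mul_norm_le (hw.partialDeriv j) hz

/-- **Trilinear bound, sup norm on the gradient of the transported field**: for smooth
`v, w, z` with `‖∂ⱼw‖ ≤ Wⱼ` pointwise,
`|∫ ⟪(v·∇)w, z⟫| ≤ (∑ⱼ Wⱼ) ‖v‖_{L²} ‖z‖_{L²}`. [folklore] -/
theorem abs_integral_inner_convect_le_of_sup_right {v : UnitAddTorus d → EuclideanSpace ℝ d}
    {w z : UnitAddTorus d → G} (hv : IsSmooth v) (hw : IsSmooth w) (hz : IsSmooth z) {W : d → ℝ}
    (hW : ∀ j x, ‖Torus.partialDeriv j w x‖ ≤ W j) :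
    |∫ x, ⟪Torus.convect v w x, z x⟫_ℝ| ≤
      (∑ j, W j) * (Real.sqrt (∫ x, ‖v x‖ ^ 2) * Real.sqrt (∫ x, ‖z x‖ ^ 2)) := by
  have hw1 : IsContDiff 1 w := hw.isContDiff (by simp)
  have hW0 : 0 ≤ ∑ j, W j := Finset.sum_nonneg fun j _ => (norm_nonneg _).trans (hW j 0)
  have hpt : ∀ x, |⟪Torus.convect v w x, z x⟫_ℝ| ≤ (∑ j, W j) * (‖v x‖ * ‖z x‖) := by
    intro x
    calc |⟪Torus.convect v w x, z x⟫_ℝ| ≤ ‖Torus.convect v w x‖ * ‖z x‖ := abs_real_inner_le_norm _ _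
      _ ≤ (‖v x‖ * ∑ j, ‖Torus.partialDeriv j w x‖) * ‖z x‖ :=
          mul_le_mul_of_nonneg_right (norm_convect_le v hw1 x) (norm_nonneg _)
      _ ≤ (‖v x‖ * ∑ j, W j) * ‖z x‖ :=
          mul_le_mul_of_nonneg_right (mul_le_mul_of_nonneg_left
            (Finset.sum_le_sum fun j _ => hW j x) (norm_nonneg _)) (norm_nonneg _)
      _ = (∑ j, W j) * (‖v x‖ * ‖z x‖) := by ring
  have hint : Integrable (fun x => ‖v x‖ * ‖z x‖) volume :=
    (hv.continuous.norm.mul hz.continuous.norm).integrable_unitAddTorus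
  calc |∫ x, ⟪Torus.convect v w x, z x⟫_ℝ| ≤ ∫ x, |⟪Torus.convect v w x, z x⟫_ℝ| := abs_integral_le_integral_abs
    _ ≤ ∫ x, (∑ j, W j) * (‖v x‖ * ‖z x‖) :=
        integral_mono_of_nonneg (Eventually.of_forall fun x => abs_nonneg _) (hint.const_mul _)
          (Eventually.of_forall hpt)
    _ = (∑ j, W j) * ∫ x, ‖v x‖ * ‖z x‖ := integral_const_mul _ _
    _ ≤ (∑ j, W j) * (Real.sqrt (∫ x, ‖v x‖ ^ 2) * Real.sqrt (∫ x, ‖z x‖ ^ 2)) :=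
        mul_le_mul_of_nonneg_left (integral_norm_mul_norm_le hv hz) hW0

end Trilinear

/-! ## The commutator estimate for pure derivatives of order `m ≥ 4` -/

section Commutator

variable {S : Finset (d → ℤ)} {c : (d → ℤ) → EuclideanSpace ℂ d}

/-- Square roots of the weighted sums: `√(M W) = √M √W`, bookkeeping. [folklore] -/
theorem sqrt_le_sqrt_mul_sqrt {x M W : ℝ} (hM : 0 ≤ M) (h : x ≤ M * W) :
    Real.sqrt x ≤ Real.sqrt M * Real.sqrt W := by
  rw [← Real.sqrt_mul hM]
  exact Real.sqrt_le_sqrt h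

/-- **The single commutator term.** For `u = realTrigPoly S c` (real coefficients on a symmetric
`S`), `m ≥ 4`, `1 ≤ a ≤ m` and `∑_{k∈S} ((1+|k|²)²)⁻¹ ≤ B`:
`|∫ ⟪(∂ᵢᵃu·∇)∂ᵢ^{m-a}u, ∂ᵢᵐu⟫| ≤ #d √B (2π)^{2m+1} √W_r · W_m`, `r = max 4 (m-1)`,
`W_s = ∑_{k∈S} (1+|k|²)ˢ ‖c k‖²` (Majda–Bertozzi 2002, proof of Prop. 3.7: sup norm on the
lower-order factor by `H² ⊂ L^∞`, `L²` norms by Parseval). [cite: MajdaBertozziCUP2002, Prop. 3.7] -/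
theorem abs_commutatorTerm_le (hS : ∀ k ∈ S, -k ∈ S) (hc : IsConjSymm c) {B : ℝ}
    (hB : ∑ k ∈ S, ((1 + freqNormSq k) ^ 2)⁻¹ ≤ B) {m a : ℕ} (hm : 4 ≤ m) (ha1 : 1 ≤ a)
    (ham : a ≤ m) (i : d) :
    |∫ x, ⟪Torus.convect ((Torus.partialDeriv i)^[a] (realTrigPoly S c))
        ((Torus.partialDeriv i)^[m - a] (realTrigPoly S c)) x,
        (Torus.partialDeriv i)^[m] (realTrigPoly S c) x⟫_ℝ| ≤
      Fintype.card d * Real.sqrt B * (2 * Real.pi) ^ (2 * m + 1) *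
        (Real.sqrt (∑ k ∈ S, (1 + freqNormSq k) ^ (max 4 (m - 1)) * ‖c k‖ ^ 2) *
          ∑ k ∈ S, (1 + freqNormSq k) ^ m * ‖c k‖ ^ 2) := by
  set u := realTrigPoly S c with hu_def
  set W : ℕ → ℝ := fun s => ∑ k ∈ S, (1 + freqNormSq k) ^ s * ‖c k‖ ^ 2 with hW
  set r := max 4 (m - 1) with hr
  have hu : IsSmooth u := isSmooth_realTrigPoly S c
  have hWmono : ∀ {s t : ℕ}, s ≤ t → W s ≤ W t := fun hst => sum_weight_pow_mul_norm_sq_mono S c hst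
  have hW0 : ∀ s, 0 ≤ W s := fun s => Finset.sum_nonneg fun k _ =>
    mul_nonneg (pow_nonneg (by linarith [freqNormSq_nonneg k]) _) (sq_nonneg _)
  have hB0 : 0 ≤ B := le_trans (Finset.sum_nonneg fun k _ => inv_nonneg.2 (sq_nonneg _)) hB
  have hπ : 0 ≤ 2 * Real.pi := by positivity
  have hπ1 : 1 ≤ 2 * Real.pi := by linarith [Real.pi_gt_three]
  have hsm : ∀ b, IsSmooth ((Torus.partialDeriv i)^[b] u) := fun b => isSmooth_iterate_partialDeriv hu i b
  -- the three kinds of factors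
  have hL2 : ∀ b, Real.sqrt (∫ x, ‖(Torus.partialDeriv i)^[b] u x‖ ^ 2) ≤
      (2 * Real.pi) ^ b * Real.sqrt (W b) := by
    intro b
    have h := sqrt_le_sqrt_mul_sqrt (pow_nonneg hπ _) (integral_norm_sq_iterate_le hS hc i b)
    rwa [show (2 * b) = b * 2 by ring, pow_mul, Real.sqrt_sq (pow_nonneg hπ _)] at h
  have hL2mixed : ∀ b j, Real.sqrt (∫ x, ‖Torus.partialDeriv j ((Torus.partialDeriv i)^[b] u) x‖ ^ 2) ≤
      (2 * Real.pi) ^ (b + 1) * Real.sqrt (W (b + 1)) := by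
    intro b j
    have h := sqrt_le_sqrt_mul_sqrt (pow_nonneg hπ _) (integral_norm_sq_mixed_le hS hc i j b)
    rwa [show (2 * (b + 1)) = (b + 1) * 2 by ring, pow_mul, Real.sqrt_sq (pow_nonneg hπ _)] at h
  have hsup : ∀ b x, ‖(Torus.partialDeriv i)^[b] u x‖ ≤
      Real.sqrt B * ((2 * Real.pi) ^ b * Real.sqrt (W (b + 2))) := by
    intro b x
    have h := sq_norm_iterate_le (c := c) hB i b x
    have h' := Real.sqrt_le_sqrt h
    rw [Real.sqrt_sq (norm_nonneg _), Real.sqrt_mul hB0, Real.sqrt_mul (pow_nonneg hπ _),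
      show (2 * b) = b * 2 by ring, pow_mul, Real.sqrt_sq (pow_nonneg hπ _)] at h'
    exact h'
  have hsupmixed : ∀ b j x, ‖Torus.partialDeriv j ((Torus.partialDeriv i)^[b] u) x‖ ≤
      Real.sqrt B * ((2 * Real.pi) ^ (b + 1) * Real.sqrt (W (b + 1 + 2))) := by
    intro b j x
    have h := sq_norm_mixed_le (c := c) hB i j b x
    have h' := Real.sqrt_le_sqrt h
    rw [Real.sqrt_sq (norm_nonneg _), Real.sqrt_mul hB0, Real.sqrt_mul (pow_nonneg hπ _),
      show (2 * (b + 1)) = (b + 1) * 2 by ring, pow_mul, Real.sqrt_sq (pow_nonneg hπ _)] at h'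
    exact h'
  have hsqW : ∀ {s t : ℕ}, s ≤ t → Real.sqrt (W s) ≤ Real.sqrt (W t) := fun hst =>
    Real.sqrt_le_sqrt (hWmono hst)
  -- key numeric step: `√(W p) √(W q) √(W m) ≤ √(W r) W m` when `{p, q}` has one index `≤ r`
  -- and the other `≤ m`
  have hkey : ∀ {p q : ℕ}, p ≤ r → q ≤ m →
      Real.sqrt (W p) * Real.sqrt (W q) * Real.sqrt (W m) ≤ Real.sqrt (W r) * W m := by
    intro p q hp hq
    calc Real.sqrt (W p) * Real.sqrt (W q) * Real.sqrt (W m)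
        ≤ Real.sqrt (W r) * Real.sqrt (W m) * Real.sqrt (W m) := by
          gcongr
          · exact hWmono hp
          · exact hWmono hq
      _ = Real.sqrt (W r) * W m := by rw [mul_assoc, Real.mul_self_sqrt (hW0 m)]
  have hcard : (Finset.univ : Finset d).card = Fintype.card d := Finset.card_univ
  rcases le_or_gt a (m - 2) with hA | hBcase
  · -- case A: sup norm on `∂ᵢᵃu`
    have hbound := abs_integral_inner_convect_le_of_sup_left (v := (Torus.partialDeriv i)^[a] u)
      (hsm (m - a)) (hsm m) (fun x => hsup a x)
    refine hbound.trans ?_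
    have hterm : ∀ j, Real.sqrt (∫ x, ‖Torus.partialDeriv j ((Torus.partialDeriv i)^[m - a] u) x‖ ^ 2) *
        Real.sqrt (∫ x, ‖(Torus.partialDeriv i)^[m] u x‖ ^ 2) ≤
        ((2 * Real.pi) ^ (m - a + 1) * Real.sqrt (W (m - a + 1))) * ((2 * Real.pi) ^ m * Real.sqrt (W m)) :=
      fun j => mul_le_mul (hL2mixed (m - a) j) (hL2 m) (Real.sqrt_nonneg _) (by positivity)
    calc Real.sqrt B * ((2 * Real.pi) ^ a * Real.sqrt (W (a + 2))) *
          ∑ j, Real.sqrt (∫ x, ‖Torus.partialDeriv j ((Torus.partialDeriv i)^[m - a] u) x‖ ^ 2) *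
            Real.sqrt (∫ x, ‖(Torus.partialDeriv i)^[m] u x‖ ^ 2)
        ≤ Real.sqrt B * ((2 * Real.pi) ^ a * Real.sqrt (W (a + 2))) *
          ∑ _j : d, ((2 * Real.pi) ^ (m - a + 1) * Real.sqrt (W (m - a + 1))) *
            ((2 * Real.pi) ^ m * Real.sqrt (W m)) :=
          mul_le_mul_of_nonneg_left (Finset.sum_le_sum fun j _ => hterm j) (by positivity)
      _ = Fintype.card d * Real.sqrt B * ((2 * Real.pi) ^ a * (2 * Real.pi) ^ (m - a + 1) * (2 * Real.pi) ^ m) *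
          (Real.sqrt (W (a + 2)) * Real.sqrt (W (m - a + 1)) * Real.sqrt (W m)) := by
          rw [Finset.sum_const, hcard, nsmul_eq_mul]; ring
      _ = Fintype.card d * Real.sqrt B * (2 * Real.pi) ^ (2 * m + 1) *
          (Real.sqrt (W (a + 2)) * Real.sqrt (W (m - a + 1)) * Real.sqrt (W m)) := by
          rw [← pow_add, ← pow_add, show a + (m - a + 1) + m = 2 * m + 1 by omega]
      _ ≤ Fintype.card d * Real.sqrt B * (2 * Real.pi) ^ (2 * m + 1) * (Real.sqrt (W r) * W m) := by
          refine mul_le_mul_of_nonneg_left ?_ (by positivity)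
          rcases le_or_gt a 1 with ha1' | ha2
          · -- `a = 1`: `a + 2 = 3 ≤ r`, `m - a + 1 = m`
            have ha : a = 1 := le_antisymm ha1' ha1
            exact hkey (by rw [ha, hr]; omega) (by omega)
          · -- `2 ≤ a ≤ m - 2`: `a + 2 ≤ m`, `m - a + 1 ≤ m - 1 ≤ r`
            rw [mul_comm (Real.sqrt (W (a + 2)))]
            exact hkey (by rw [hr]; omega) (by omega)
  · -- case B: `a ≥ m - 1`, sup norm on `∇∂ᵢ^{m-a}u`
    have hbound := abs_integral_inner_convect_le_of_sup_right (v := (Torus.partialDeriv i)^[a] u)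
      (hsm a) (hsm (m - a)) (hsm m) (fun j x => hsupmixed (m - a) j x)
    refine hbound.trans ?_
    calc (∑ _j : d, Real.sqrt B * ((2 * Real.pi) ^ (m - a + 1) * Real.sqrt (W (m - a + 1 + 2)))) *
          (Real.sqrt (∫ x, ‖(Torus.partialDeriv i)^[a] u x‖ ^ 2) *
            Real.sqrt (∫ x, ‖(Torus.partialDeriv i)^[m] u x‖ ^ 2))
        ≤ (∑ _j : d, Real.sqrt B * ((2 * Real.pi) ^ (m - a + 1) * Real.sqrt (W (m - a + 1 + 2)))) *
          (((2 * Real.pi) ^ a * Real.sqrt (W a)) * ((2 * Real.pi) ^ m * Real.sqrt (W m))) :=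
          mul_le_mul_of_nonneg_left (mul_le_mul (hL2 a) (hL2 m) (Real.sqrt_nonneg _) (by positivity))
            (Finset.sum_nonneg fun j _ => by positivity)
      _ = Fintype.card d * Real.sqrt B * ((2 * Real.pi) ^ (m - a + 1) * (2 * Real.pi) ^ a * (2 * Real.pi) ^ m) *
          (Real.sqrt (W (m - a + 1 + 2)) * Real.sqrt (W a) * Real.sqrt (W m)) := by
          rw [Finset.sum_const, hcard, nsmul_eq_mul]; ring
      _ = Fintype.card d * Real.sqrt B * (2 * Real.pi) ^ (2 * m + 1) *
          (Real.sqrt (W (m - a + 1 + 2)) * Real.sqrt (W a) * Real.sqrt (W m)) := by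
          rw [← pow_add, ← pow_add, show m - a + 1 + a + m = 2 * m + 1 by omega]
      _ ≤ Fintype.card d * Real.sqrt B * (2 * Real.pi) ^ (2 * m + 1) * (Real.sqrt (W r) * W m) := by
          refine mul_le_mul_of_nonneg_left ?_ (by positivity)
          exact hkey (by rw [hr]; omega) ham

/-- **The commutator estimate** (Majda–Bertozzi 2002, Prop. 3.7, the `H^m` energy estimate, for
pure derivatives of a real divergence-free trigonometric polynomial `u = realTrigPoly S c`):
for `m ≥ 4`,
`|∫ ⟪∂ᵢᵐ[(u·∇)u], ∂ᵢᵐu⟫| ≤ 2ᵐ #d √B (2π)^{2m+1} √W_r · W_m`, `r = max 4 (m-1)` — the Leibniz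
expansion (`Torus.iterate_partialDeriv_convect`), the cancellation of the top-order term
`∫ ⟪(u·∇)∂ᵢᵐu, ∂ᵢᵐu⟫ = 0` (`div u = 0`), and `abs_commutatorTerm_le` for the others.
[cite: MajdaBertozziCUP2002, Prop. 3.7] -/
theorem abs_integral_inner_iterate_convect_le (hS : ∀ k ∈ S, -k ∈ S) (hc : IsConjSymm c)
    (hT : IsTransversal S c) {B : ℝ} (hB : ∑ k ∈ S, ((1 + freqNormSq k) ^ 2)⁻¹ ≤ B) {m : ℕ}
    (hm : 4 ≤ m) (i : d) :
    |∫ x, ⟪(Torus.partialDeriv i)^[m] (Torus.convect (realTrigPoly S c) (realTrigPoly S c)) x,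
        (Torus.partialDeriv i)^[m] (realTrigPoly S c) x⟫_ℝ| ≤
      2 ^ m * (Fintype.card d * Real.sqrt B * (2 * Real.pi) ^ (2 * m + 1)) *
        (Real.sqrt (∑ k ∈ S, (1 + freqNormSq k) ^ (max 4 (m - 1)) * ‖c k‖ ^ 2) *
          ∑ k ∈ S, (1 + freqNormSq k) ^ m * ‖c k‖ ^ 2) := by
  set u := realTrigPoly S c with hu_def
  set K := Fintype.card d * Real.sqrt B * (2 * Real.pi) ^ (2 * m + 1) *
    (Real.sqrt (∑ k ∈ S, (1 + freqNormSq k) ^ (max 4 (m - 1)) * ‖c k‖ ^ 2) *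
      ∑ k ∈ S, (1 + freqNormSq k) ^ m * ‖c k‖ ^ 2) with hK
  have hu : IsSmooth u := isSmooth_realTrigPoly S c
  have hdiv : IsDivFree u := isDivFree_realTrigPoly hT
  have hsm : ∀ b, IsSmooth ((Torus.partialDeriv i)^[b] u) := fun b => isSmooth_iterate_partialDeriv hu i b
  have hW0 : ∀ s : ℕ, 0 ≤ ∑ k ∈ S, (1 + freqNormSq k) ^ s * ‖c k‖ ^ 2 := fun s =>
    Finset.sum_nonneg fun k _ => mul_nonneg (pow_nonneg (by linarith [freqNormSq_nonneg k]) _) (sq_nonneg _)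
  have hB0 : 0 ≤ B := le_trans (Finset.sum_nonneg fun k _ => inv_nonneg.2 (sq_nonneg _)) hB
  have hK0 : 0 ≤ K := by rw [hK]; have := hW0 m; positivity
  -- the terms of the Leibniz expansion
  set T : ℕ → ℝ := fun a => ∫ x, ⟪Torus.convect ((Torus.partialDeriv i)^[a] u)
    ((Torus.partialDeriv i)^[m - a] u) x, (Torus.partialDeriv i)^[m] u x⟫_ℝ with hT_def
  have hint : ∀ a, Integrable (fun x => ⟪Torus.convect ((Torus.partialDeriv i)^[a] u)
      ((Torus.partialDeriv i)^[m - a] u) x, (Torus.partialDeriv i)^[m] u x⟫_ℝ) volume := fun a =>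
    (((hsm a).convect (hsm (m - a))).inner (hsm m)).integrable
  -- expand
  have hexp : ∫ x, ⟪(Torus.partialDeriv i)^[m] (Torus.convect u u) x, (Torus.partialDeriv i)^[m] u x⟫_ℝ =
      ∑ a ∈ Finset.range (m + 1), (m.choose a : ℝ) * T a := by
    rw [iterate_partialDeriv_convect hu hu i m]
    have hpt : ∀ x, ⟪(∑ a ∈ Finset.range (m + 1), (m.choose a) •
        Torus.convect ((Torus.partialDeriv i)^[a] u) ((Torus.partialDeriv i)^[m - a] u)) x,
        (Torus.partialDeriv i)^[m] u x⟫_ℝ =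
        ∑ a ∈ Finset.range (m + 1), (m.choose a : ℝ) * ⟪Torus.convect ((Torus.partialDeriv i)^[a] u)
          ((Torus.partialDeriv i)^[m - a] u) x, (Torus.partialDeriv i)^[m] u x⟫_ℝ := by
      intro x
      rw [Finset.sum_apply, sum_inner]
      refine Finset.sum_congr rfl fun a _ => ?_
      rw [Pi.smul_apply, ← Nat.cast_smul_eq_nsmul ℝ, real_inner_smul_left]
    simp_rw [hpt]
    rw [integral_finsetSum _ fun a _ => (hint a).const_mul _]
    refine Finset.sum_congr rfl fun a _ => ?_
    rw [integral_const_mul]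
  -- the top-order term cancels
  have hT0 : T 0 = 0 := by
    simp only [hT_def, Function.iterate_zero, id_eq, Nat.sub_zero]
    have h := integral_inner_convect_eq_neg hu hdiv (hsm m) (hsm m)
    have hsym : ∫ x, ⟪(Torus.partialDeriv i)^[m] u x, Torus.convect u ((Torus.partialDeriv i)^[m] u) x⟫_ℝ =
        ∫ x, ⟪Torus.convect u ((Torus.partialDeriv i)^[m] u) x, (Torus.partialDeriv i)^[m] u x⟫_ℝ :=
      integral_congr_ae (ae_of_all _ fun x => real_inner_comm _ _)
    rw [hsym] at h
    linarith
  -- every term is bounded by `K`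
  have hTa : ∀ a ∈ Finset.range (m + 1), |T a| ≤ K := by
    intro a ha
    have ham : a ≤ m := Nat.lt_succ_iff.1 (Finset.mem_range.1 ha)
    rcases Nat.eq_zero_or_pos a with h0 | hpos
    · rw [h0, hT0, abs_zero]; exact hK0
    · exact abs_commutatorTerm_le hS hc hB hm hpos ham i
  rw [hexp]
  calc |∑ a ∈ Finset.range (m + 1), (m.choose a : ℝ) * T a|
      ≤ ∑ a ∈ Finset.range (m + 1), |(m.choose a : ℝ) * T a| := Finset.abs_sum_le_sum_abs _ _
    _ ≤ ∑ a ∈ Finset.range (m + 1), (m.choose a : ℝ) * K := by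
        refine Finset.sum_le_sum fun a ha => ?_
        rw [abs_mul, Nat.abs_cast]
        exact mul_le_mul_of_nonneg_left (hTa a ha) (Nat.cast_nonneg _)
    _ = 2 ^ m * K := by
        rw [← Finset.sum_mul, ← Nat.cast_sum, Nat.sum_range_choose]; push_cast; ring
    _ = _ := by rw [hK]; ring

end Commutator

/-! ## Fourier side: weighted pairings with the Galerkin field -/

section Fourier

variable {S : Finset (d → ℤ)}

omit [Fintype d] [DecidableEq d] in
/-- The norm of the pure derivative symbol: `‖(2πi kᵢ)ᵐ‖ = (2π|kᵢ|)ᵐ`. [folklore] -/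
theorem norm_derivSymbol_pow (k : d → ℤ) (i : d) (m : ℕ) :
    ‖(2 * Real.pi * Complex.I * (k i : ℂ)) ^ m‖ = (2 * Real.pi * |(k i : ℝ)|) ^ m := by
  rw [norm_pow, norm_mul, norm_mul, norm_mul, Complex.norm_two, Complex.norm_real, Complex.norm_I,
    mul_one, Real.norm_eq_abs, abs_of_pos Real.pi_pos, Complex.norm_intCast]

/-- **Fourier coefficients of pure iterated derivatives** of a smooth real vector field:
`𝓕(∂ᵢᵐ F)(k) = (2πi kᵢ)ᵐ 𝓕(F)(k)`. [folklore] -/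
theorem mFourierCoeff_complexify_iterate_partialDeriv {F : UnitAddTorus d → EuclideanSpace ℝ d}
    (hF : IsSmooth F) (i : d) (m : ℕ) (k : d → ℤ) :
    mFourierCoeff (EuclideanSpace.complexify ∘ (Torus.partialDeriv i)^[m] F) k =
      (2 * Real.pi * Complex.I * (k i : ℂ)) ^ m • mFourierCoeff (EuclideanSpace.complexify ∘ F) k := by
  induction m with
  | zero => simp
  | succ m IH =>
    rw [iterate_succ_apply', mFourierCoeff_complexify_partialDeriv (isSmooth_iterate_partialDeriv hF i m),
      IH, smul_smul, ← pow_succ']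

/-- **The weighted convection pairing is the physical-space commutator pairing**: for real
coefficients `c` on a symmetric `S` and `u = realTrigPoly S c`,
`∑_{k∈S} (2π|kᵢ|)^{2m} Re⟪c k, 𝓕[(u·∇)u](k)⟫ = ∫ ⟪∂ᵢᵐu, ∂ᵢᵐ[(u·∇)u]⟫` (Parseval against the
band-limited `∂ᵢ^{2m}u`). [folklore] -/
theorem sum_weight_re_inner_convectionCoeff (hS : ∀ k ∈ S, -k ∈ S) {c : (d → ℤ) → EuclideanSpace ℂ d}
    (hc : IsConjSymm c) (i : d) (m : ℕ) :
    ∑ k ∈ S, ((2 * Real.pi * |(k i : ℝ)|) ^ m) ^ 2 * (inner ℂ (c k) (convectionCoeff S c c k)).re =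
      ∫ x, ⟪(Torus.partialDeriv i)^[m] (realTrigPoly S c) x,
        (Torus.partialDeriv i)^[m] (Torus.convect (realTrigPoly S c) (realTrigPoly S c)) x⟫_ℝ := by
  have hu : IsSmooth (realTrigPoly S c) := isSmooth_realTrigPoly S c
  have hW : IsSmooth ((Torus.partialDeriv i)^[m] (Torus.convect (realTrigPoly S c) (realTrigPoly S c))) :=
    isSmooth_iterate_partialDeriv (hu.convect hu) i m
  rw [iterate_partialDeriv_realTrigPoly, integral_inner_realTrigPoly_left hS (hc.iterate_deriv i m) (hW.memLp 2)]
  refine Finset.sum_congr rfl fun k _ => ?_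
  rw [mFourierCoeff_complexify_iterate_partialDeriv (hu.convect hu), mFourierCoeff_convect_realTrigPoly hS hc hc,
    inner_smul_left, inner_smul_right, ← mul_assoc, Complex.conj_mul', ← Complex.ofReal_pow,
    Complex.re_ofReal_mul, norm_derivSymbol_pow]

omit [DecidableEq d] in
/-- **Master identity, weighted form.** For a real divergence-free coefficient vector `c` on a
symmetric `S`, force coefficients `g` and a real weight `w`,
`∑_k w_k Re⟪c k, V(g, c)_k⟫ = -ν ∑_k 4π²|k|² w_k ‖c k‖² + ∑_k w_k Re⟪c k, g k⟫
  - ∑_{k∈S} w_k Re⟪c̄ k, 𝓕[(u·∇)u](k)⟫`, `u = realTrigPoly S c̄` (the Leray multiplier drops out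
against the transversal `c k`). [cite: RobinsonRodrigoSadowski2016, Thm. 4.4 Step 2 (4.6)] -/
theorem sum_weight_re_inner_galerkinRHS (ν : ℝ) {g c : ↥S → EuclideanSpace ℂ d}
    (hc : c ∈ galerkinSubspace S) (w : (d → ℤ) → ℝ) :
    ∑ k : ↥S, w (k : d → ℤ) * (inner ℂ (c k) (galerkinRHS S ν g c k)).re =
      -(ν * ∑ k : ↥S, 4 * Real.pi ^ 2 * freqNormSq (k : d → ℤ) * (w (k : d → ℤ) * ‖c k‖ ^ 2)) +
        ∑ k : ↥S, w (k : d → ℤ) * (inner ℂ (c k) (g k)).re -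
        ∑ k : ↥S, w (k : d → ℤ) *
          (inner ℂ (c k) (convectionCoeff S (coeffExt S c) (coeffExt S c) (k : d → ℤ))).re := by
  have hsplit : ∀ k : ↥S, w (k : d → ℤ) * (inner ℂ (c k) (galerkinRHS S ν g c k)).re =
      -(ν * (4 * Real.pi ^ 2 * freqNormSq (k : d → ℤ) * (w (k : d → ℤ) * ‖c k‖ ^ 2))) +
        w (k : d → ℤ) * (inner ℂ (c k) (g k)).re -
        w (k : d → ℤ) * (inner ℂ (c k) (convectionCoeff S (coeffExt S c) (coeffExt S c) (k : d → ℤ))).re := by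
    intro k
    rw [galerkinRHS_apply, galerkinField, inner_add_right, Complex.add_re,
      inner_leraySym_right_of_transversal _ _ (by simpa using hc.2 k), inner_sub_right,
      Complex.sub_re, inner_neg_right, Complex.neg_re, inner_smul_right, Complex.re_ofReal_mul]
    simp only [coeffExt_coe]
    have hcc : (inner ℂ (c k) (c k)).re = ‖c k‖ ^ 2 := by
      rw [← real_inner_eq_re_inner_euclidean, real_inner_self_eq_norm_sq]
    rw [hcc]
    ring
  rw [Finset.sum_congr rfl fun k _ => hsplit k, Finset.sum_sub_distrib, Finset.sum_add_distrib,
    Finset.sum_neg_distrib, ← Finset.mul_sum]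

/-- The unweighted convection pairing vanishes: `∑_{k∈S} Re⟪c̄ k, 𝓕[(u·∇)u](k)⟫ = ∫ ⟪u, (u·∇)u⟫ = 0`
for real divergence-free `c̄` (`u = realTrigPoly S c̄`). [cite: RobinsonRodrigoSadowski2016, Thm. 4.4 Step 2 (4.7)] -/
theorem sum_re_inner_convectionCoeff_eq_zero (hS : ∀ k ∈ S, -k ∈ S) {c : (d → ℤ) → EuclideanSpace ℂ d}
    (hc : IsConjSymm c) (hT : IsTransversal S c) :
    ∑ k ∈ S, (inner ℂ (c k) (convectionCoeff S c c k)).re = 0 := by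
  have hu : IsSmooth (realTrigPoly S c) := isSmooth_realTrigPoly S c
  have hdiv : IsDivFree (realTrigPoly S c) := isDivFree_realTrigPoly hT
  have h1 := integral_inner_realTrigPoly_left hS hc ((hu.convect hu).memLp 2)
  simp_rw [mFourierCoeff_convect_realTrigPoly hS hc hc] at h1
  rw [← h1]
  have h2 : ∫ x, ⟪realTrigPoly S c x, Torus.convect (realTrigPoly S c) (realTrigPoly S c) x⟫_ℝ =
      ∫ x, ⟪Torus.convect (realTrigPoly S c) (realTrigPoly S c) x, realTrigPoly S c x⟫_ℝ :=
    integral_congr_ae (ae_of_all _ fun x => real_inner_comm _ _)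
  rw [h2]
  exact FunctionSpaces.Torus.integral_inner_convect_self_eq_zero hu hdiv

end Fourier

/-! ## The weighted energies along a solution of the damped Galerkin system -/

section ODE

variable {S : Finset (d → ℤ)}

omit [DecidableEq d] in
/-- **Derivative of a weighted coefficient energy** along a differentiable curve in `S → ℂ^d`:
`d/dt ∑_k w_k ‖β k‖² = ∑_k w_k · 2 Re⟪β k, β' k⟫`. [folklore] -/
theorem hasDerivWithinAt_weightedEnergy {β : ℝ → ↥S → EuclideanSpace ℂ d}
    {v : ↥S → EuclideanSpace ℂ d} {s : Set ℝ} {t : ℝ} (h : HasDerivWithinAt β v s t)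
    (w : (d → ℤ) → ℝ) :
    HasDerivWithinAt (fun τ => ∑ k : ↥S, w (k : d → ℤ) * ‖β τ k‖ ^ 2)
      (∑ k : ↥S, w (k : d → ℤ) * (2 * (inner ℂ (β t k) (v k)).re)) s t := by
  have hk : ∀ k : ↥S, HasDerivWithinAt (fun τ => β τ k) (v k) s t := fun k =>
    (ContinuousLinearMap.proj (R := ℝ) (φ := fun _ : ↥S => EuclideanSpace ℂ d) k).hasFDerivAt
      |>.comp_hasDerivWithinAt t h
  have := HasDerivWithinAt.fun_sum (u := Finset.univ) fun k _ => ((hk k).norm_sq).const_mul (w (k : d → ℤ))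
  simp only [real_inner_eq_re_inner_euclidean] at this
  convert this using 1

omit [DecidableEq d] in
/-- **The weighted energy inequality in differential form.** For a real divergence-free
coefficient vector `c` on a symmetric `S`, viscosity `ν ≥ 0`, a nonnegative damping symbol `σ`
(the force `g k = -σ(k) c k`: fractional dissipation `σ = ν'(4π²|k|²)^γ`, or none) and a
nonnegative weight `w`: the derivative value of `∑_k w_k ‖c k‖²` along `ċ = V(-σc, c)` satisfies
`∑_k w_k · 2Re⟪c k, V_k⟫ ≤ -2 ∑_{k∈S} w_k Re⟪c̄ k, 𝓕[(u·∇)u](k)⟫` — the Stokes and damping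
terms are nonpositive. [folklore] -/
theorem weightedPairing_le {ν : ℝ} (hν : 0 ≤ ν) {σ : (d → ℤ) → ℝ} (hσ : ∀ k, 0 ≤ σ k)
    {c : ↥S → EuclideanSpace ℂ d} (hc : c ∈ galerkinSubspace S) {w : (d → ℤ) → ℝ}
    (hw : ∀ k, 0 ≤ w k) :
    ∑ k : ↥S, w (k : d → ℤ) * (2 * (inner ℂ (c k)
        (galerkinRHS S ν (fun k : ↥S => -((((σ (k : d → ℤ)) : ℝ) : ℂ) • c k)) c k)).re) ≤
      -(2 * ∑ k ∈ S, w k *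
        (inner ℂ (coeffExt S c k) (convectionCoeff S (coeffExt S c) (coeffExt S c) k)).re) := by
  have h2 : ∑ k : ↥S, w (k : d → ℤ) * (2 * (inner ℂ (c k)
      (galerkinRHS S ν (fun k : ↥S => -((((σ (k : d → ℤ)) : ℝ) : ℂ) • c k)) c k)).re) =
      2 * ∑ k : ↥S, w (k : d → ℤ) * (inner ℂ (c k)
        (galerkinRHS S ν (fun k : ↥S => -((((σ (k : d → ℤ)) : ℝ) : ℂ) • c k)) c k)).re := by
    rw [Finset.mul_sum]
    exact Finset.sum_congr rfl fun k _ => by ring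
  rw [h2]
  -- the damping term
  have hforce : ∑ k : ↥S, w (k : d → ℤ) * (inner ℂ (c k) (-((((σ (k : d → ℤ)) : ℝ) : ℂ) • c k))).re =
      -∑ k : ↥S, σ (k : d → ℤ) * (w (k : d → ℤ) * ‖c k‖ ^ 2) := by
    rw [← Finset.sum_neg_distrib]
    refine Finset.sum_congr rfl fun k _ => ?_
    rw [inner_neg_right, Complex.neg_re, inner_smul_right, Complex.re_ofReal_mul,
      ← real_inner_eq_re_inner_euclidean, real_inner_self_eq_norm_sq]
    ring
  -- the convection term over the subtype is the one over `S`
  have hconv : ∑ k : ↥S, w (k : d → ℤ) *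
      (inner ℂ (c k) (convectionCoeff S (coeffExt S c) (coeffExt S c) (k : d → ℤ))).re =
      ∑ k ∈ S, w k * (inner ℂ (coeffExt S c k) (convectionCoeff S (coeffExt S c) (coeffExt S c) k)).re :=
    (sum_coeffExt (fun k v => w k * (inner ℂ v (convectionCoeff S (coeffExt S c) (coeffExt S c) k)).re) c).symm
  have hstokes : 0 ≤ ν * ∑ k : ↥S, 4 * Real.pi ^ 2 * freqNormSq (k : d → ℤ) * (w (k : d → ℤ) * ‖c k‖ ^ 2) :=
    mul_nonneg hν (Finset.sum_nonneg fun k _ => mul_nonneg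
      (mul_nonneg (by positivity) (freqNormSq_nonneg _)) (mul_nonneg (hw _) (sq_nonneg _)))
  have hdamp : 0 ≤ ∑ k : ↥S, σ (k : d → ℤ) * (w (k : d → ℤ) * ‖c k‖ ^ 2) :=
    Finset.sum_nonneg fun k _ => mul_nonneg (hσ _) (mul_nonneg (hw _) (sq_nonneg _))
  have hmain : ∑ k : ↥S, w (k : d → ℤ) * (inner ℂ (c k)
      (galerkinRHS S ν (fun k : ↥S => -((((σ (k : d → ℤ)) : ℝ) : ℂ) • c k)) c k)).re ≤
      -(∑ k ∈ S, w k *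
        (inner ℂ (coeffExt S c k) (convectionCoeff S (coeffExt S c) (coeffExt S c) k)).re) := by
    rw [sum_weight_re_inner_galerkinRHS ν hc w, hforce, hconv]
    linarith
  linarith

/-- **The `L²` energy is nonincreasing**: the derivative value of `∑_k ‖c k‖²` along the damped
Galerkin field is `≤ 0` (CDLDR 2018, §9: "`d/dt ∫|w|² = -2∫|(-Δ)^{α/2}w|²`"; RRS 2016, (4.7)).
[cite: RobinsonRodrigoSadowski2016, Thm. 4.4 Step 2 (4.7)] -/
theorem energyPairing_le (hS : ∀ k ∈ S, -k ∈ S) {ν : ℝ} (hν : 0 ≤ ν) {σ : (d → ℤ) → ℝ}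
    (hσ : ∀ k, 0 ≤ σ k) {c : ↥S → EuclideanSpace ℂ d} (hc : c ∈ galerkinSubspace S) :
    ∑ k : ↥S, (1 : ℝ) * (2 * (inner ℂ (c k)
        (galerkinRHS S ν (fun k : ↥S => -((((σ (k : d → ℤ)) : ℝ) : ℂ) • c k)) c k)).re) ≤ 0 := by
  have h := weightedPairing_le (w := fun _ => (1 : ℝ)) hν hσ hc (fun _ => zero_le_one)
  simp only [one_mul] at h ⊢
  rw [sum_re_inner_convectionCoeff_eq_zero hS (hc.1.isConjSymm_coeffExt hS) hc.2.isTransversal_coeffExt,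
    mul_zero, neg_zero] at h
  exact h

/-- **The pure-derivative energy inequality**: the derivative value of
`∑_k (2π|kᵢ|)^{2m} ‖c k‖² = ∫ ‖∂ᵢᵐu‖²` along the damped Galerkin field is at most
`2 · 2ᵐ #d √B (2π)^{2m+1} √W_r W_m`, `r = max 4 (m-1)`, for `m ≥ 4` (Majda–Bertozzi 2002,
Prop. 3.7 for the Galerkin system; the projection `P_N` and the Leray multiplier are invisible in
the pairing with `∂ᵢ^{2m}u`). [cite: MajdaBertozziCUP2002, Prop. 3.7] -/
theorem purePairing_le (hS : ∀ k ∈ S, -k ∈ S) {ν : ℝ} (hν : 0 ≤ ν) {σ : (d → ℤ) → ℝ}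
    (hσ : ∀ k, 0 ≤ σ k) {c : ↥S → EuclideanSpace ℂ d} (hc : c ∈ galerkinSubspace S) {B : ℝ}
    (hB : ∑ k ∈ S, ((1 + freqNormSq k) ^ 2)⁻¹ ≤ B) {m : ℕ} (hm : 4 ≤ m) (i : d) :
    ∑ k : ↥S, ((2 * Real.pi * |((k : d → ℤ) i : ℝ)|) ^ m) ^ 2 * (2 * (inner ℂ (c k)
        (galerkinRHS S ν (fun k : ↥S => -((((σ (k : d → ℤ)) : ℝ) : ℂ) • c k)) c k)).re) ≤
      2 * (2 ^ m * (Fintype.card d * Real.sqrt B * (2 * Real.pi) ^ (2 * m + 1)) *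
        (Real.sqrt (∑ k ∈ S, (1 + freqNormSq k) ^ (max 4 (m - 1)) * ‖coeffExt S c k‖ ^ 2) *
          ∑ k ∈ S, (1 + freqNormSq k) ^ m * ‖coeffExt S c k‖ ^ 2)) := by
  have hcs : IsConjSymm (coeffExt S c) := hc.1.isConjSymm_coeffExt hS
  have hct : IsTransversal S (coeffExt S c) := hc.2.isTransversal_coeffExt
  have h := weightedPairing_le (w := fun k => ((2 * Real.pi * |(k i : ℝ)|) ^ m) ^ 2) hν hσ hc
    (fun _ => sq_nonneg _)
  refine h.trans ?_
  rw [sum_weight_re_inner_convectionCoeff hS hcs i m, neg_mul_eq_mul_neg]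
  refine mul_le_mul_of_nonneg_left ?_ (by norm_num)
  have habs := abs_integral_inner_iterate_convect_le hS hcs hct hB hm i
  have hsym : ∫ x, ⟪(Torus.partialDeriv i)^[m] (realTrigPoly S (coeffExt S c)) x,
      (Torus.partialDeriv i)^[m] (Torus.convect (realTrigPoly S (coeffExt S c))
        (realTrigPoly S (coeffExt S c))) x⟫_ℝ =
      ∫ x, ⟪(Torus.partialDeriv i)^[m] (Torus.convect (realTrigPoly S (coeffExt S c))
        (realTrigPoly S (coeffExt S c))) x,
        (Torus.partialDeriv i)^[m] (realTrigPoly S (coeffExt S c)) x⟫_ℝ :=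
    integral_congr_ae (ae_of_all _ fun x => real_inner_comm _ _)
  rw [hsym]
  exact (neg_le_abs _).trans habs

end ODE

/-! ## Comparison of the Sobolev weights with the pure-derivative weights -/

section Weights

omit [DecidableEq d] in
/-- **Jensen**: `(1 + |k|²)ᵐ ≤ (#d + 1)^{m-1} (1 + ∑ᵢ (2π|kᵢ|)^{2m})` for `m ≥ 1` (power mean over the
`#d + 1` numbers `1, k₁², …, k_d²`, and `2π ≥ 1`). [folklore] -/
theorem weight_pow_le_pureWeight (k : d → ℤ) {m : ℕ} (hm : 1 ≤ m) :
    (1 + freqNormSq k) ^ m ≤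
      ((Fintype.card d : ℝ) + 1) ^ (m - 1) * (1 + ∑ i, ((2 * Real.pi * |(k i : ℝ)|) ^ m) ^ 2) := by
  obtain ⟨n, rfl⟩ : ∃ n, m = n + 1 := ⟨m - 1, by omega⟩
  simp only [Nat.add_sub_cancel]
  -- the family `1, k₁², …` indexed by `Option d`
  set f : Option d → ℝ := fun o => Option.elim o 1 fun i => ((k i : ℝ)) ^ 2 with hf
  have hf0 : ∀ o ∈ (Finset.univ : Finset (Option d)), 0 ≤ f o := by
    rintro (_ | i) _
    · simp [hf]
    · simp [hf]; positivity
  have hsum : ∑ o, f o = 1 + freqNormSq k := by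
    rw [Fintype.sum_option]; simp [hf, freqNormSq]
  have hsum' : ∑ o, f o ^ (n + 1) = 1 + ∑ i, (((k i : ℝ)) ^ 2) ^ (n + 1) := by
    rw [Fintype.sum_option]; simp [hf]
  have hcard : ((Finset.univ : Finset (Option d)).card : ℝ) = (Fintype.card d : ℝ) + 1 := by
    rw [Finset.card_univ, Fintype.card_option]; push_cast; ring
  have hJ := pow_sum_div_card_le_sum_pow hf0 n
  rw [hsum, hsum', hcard] at hJ
  have hpos : (0 : ℝ) < ((Fintype.card d : ℝ) + 1) ^ n := by positivity
  rw [div_le_iff₀ hpos] at hJ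
  refine hJ.trans ?_
  rw [mul_comm]
  refine mul_le_mul_of_nonneg_left ?_ hpos.le
  refine add_le_add le_rfl (Finset.sum_le_sum fun i _ => ?_)
  have h1 : ((k i : ℝ)) ^ 2 ≤ (2 * Real.pi * |(k i : ℝ)|) ^ 2 := by
    rw [mul_pow, sq_abs]
    have hπ : (1 : ℝ) ≤ (2 * Real.pi) ^ 2 := by nlinarith [Real.pi_gt_three]
    nlinarith [sq_nonneg ((k i : ℝ))]
  calc (((k i : ℝ)) ^ 2) ^ (n + 1) ≤ ((2 * Real.pi * |(k i : ℝ)|) ^ 2) ^ (n + 1) :=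
        pow_le_pow_left₀ (sq_nonneg _) h1 _
    _ = ((2 * Real.pi * |(k i : ℝ)|) ^ (n + 1)) ^ 2 := by rw [← pow_mul, ← pow_mul, Nat.mul_comm]

omit [DecidableEq d] in
/-- Conversely `1 + ∑ᵢ (2π|kᵢ|)^{2m} ≤ (1 + #d (2π)^{2m}) (1 + |k|²)ᵐ`. [folklore] -/
theorem pureWeight_le_weight_pow (k : d → ℤ) (m : ℕ) :
    1 + ∑ i, ((2 * Real.pi * |(k i : ℝ)|) ^ m) ^ 2 ≤
      (1 + Fintype.card d * (2 * Real.pi) ^ (2 * m)) * (1 + freqNormSq k) ^ m := by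
  have hw : 1 ≤ (1 + freqNormSq k) ^ m := one_le_pow₀ (by linarith [freqNormSq_nonneg k])
  have h1 : ∑ i, ((2 * Real.pi * |(k i : ℝ)|) ^ m) ^ 2 ≤
      ∑ _i : d, (2 * Real.pi) ^ (2 * m) * (1 + freqNormSq k) ^ m :=
    Finset.sum_le_sum fun i _ => derivSymbol_sq_pow_le k i m
  rw [Finset.sum_const, Finset.card_univ, nsmul_eq_mul] at h1
  have h0 : 0 ≤ (Fintype.card d : ℝ) * ((2 * Real.pi) ^ (2 * m) * (1 + freqNormSq k) ^ m) := by
    have := freqNormSq_nonneg k; positivity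
  nlinarith

variable {S : Finset (d → ℤ)}

omit [DecidableEq d] in
/-- `W_s ≤ (#d+1)^{m-1} P_m` for `s ≤ m`, `1 ≤ m`: the Sobolev sums are controlled by the
pure-derivative energy `P_m = ∑_k (1 + ∑ᵢ (2π|kᵢ|)^{2m}) ‖c k‖²`. [folklore] -/
theorem sobolevSum_le_pureEnergy (c : ↥S → EuclideanSpace ℂ d) {s m : ℕ} (hs : s ≤ m) (hm : 1 ≤ m) :
    ∑ k ∈ S, (1 + freqNormSq k) ^ s * ‖coeffExt S c k‖ ^ 2 ≤
      ((Fintype.card d : ℝ) + 1) ^ (m - 1) *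
        ∑ k : ↥S, (1 + ∑ i, ((2 * Real.pi * |((k : d → ℤ) i : ℝ)|) ^ m) ^ 2) * ‖c k‖ ^ 2 := by
  refine (sum_weight_pow_mul_norm_sq_mono S (coeffExt S c) hs).trans ?_
  rw [sum_coeffExt (fun k v => (1 + freqNormSq k) ^ m * ‖v‖ ^ 2), Finset.mul_sum]
  refine Finset.sum_le_sum fun k _ => ?_
  rw [← mul_assoc]
  exact mul_le_mul_of_nonneg_right (weight_pow_le_pureWeight _ hm) (sq_nonneg _)

omit [DecidableEq d] in
/-- `P_m ≤ (1 + #d (2π)^{2m}) W_m`. [folklore] -/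
theorem pureEnergy_le_sobolevSum (c : ↥S → EuclideanSpace ℂ d) (m : ℕ) :
    ∑ k : ↥S, (1 + ∑ i, ((2 * Real.pi * |((k : d → ℤ) i : ℝ)|) ^ m) ^ 2) * ‖c k‖ ^ 2 ≤
      (1 + Fintype.card d * (2 * Real.pi) ^ (2 * m)) *
        ∑ k ∈ S, (1 + freqNormSq k) ^ m * ‖coeffExt S c k‖ ^ 2 := by
  rw [sum_coeffExt (fun k v => (1 + freqNormSq k) ^ m * ‖v‖ ^ 2), Finset.mul_sum]
  refine Finset.sum_le_sum fun k _ => ?_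
  rw [← mul_assoc]
  exact mul_le_mul_of_nonneg_right (pureWeight_le_weight_pow _ m) (sq_nonneg _)

end Weights

/-! ## The pure-derivative energy along a solution: differential inequality -/

section Solution

variable {S : Finset (d → ℤ)}

/-- **The differential inequality for `P_m = ∑_k (1 + ∑ᵢ (2π|kᵢ|)^{2m}) ‖β k‖²`** along a
solution of the damped Galerkin system `β' = V(-σβ, β)` (`ν ≥ 0`, `σ ≥ 0`), `m ≥ 4`: `P_m` is
differentiable within `s` at `t` with derivative value
`≤ #d · 2 · 2ᵐ #d √B (2π)^{2m+1} · √W_r W_m`, `r = max 4 (m-1)`, `W_s = ∑_{k∈S} (1+|k|²)ˢ ‖β̄ k‖²`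
(the `L²` part is nonincreasing, each pure part obeys `purePairing_le`).
[cite: MajdaBertozziCUP2002, Prop. 3.7] -/
theorem hasDerivWithinAt_pureEnergy (hS : ∀ k ∈ S, -k ∈ S) {ν : ℝ} (hν : 0 ≤ ν) {σ : (d → ℤ) → ℝ}
    (hσ : ∀ k, 0 ≤ σ k) {B : ℝ} (hB : ∑ k ∈ S, ((1 + freqNormSq k) ^ 2)⁻¹ ≤ B) {m : ℕ} (hm : 4 ≤ m)
    {β : ℝ → ↥S → EuclideanSpace ℂ d} {s : Set ℝ} {t : ℝ}
    (h : HasDerivWithinAt β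
      (galerkinRHS S ν (fun k : ↥S => -((((σ (k : d → ℤ)) : ℝ) : ℂ) • β t k)) (β t)) s t)
    (hβ : β t ∈ galerkinSubspace S) :
    HasDerivWithinAt (fun τ => ∑ k : ↥S, (1 + ∑ i, ((2 * Real.pi * |((k : d → ℤ) i : ℝ)|) ^ m) ^ 2) * ‖β τ k‖ ^ 2)
      (∑ k : ↥S, (1 + ∑ i, ((2 * Real.pi * |((k : d → ℤ) i : ℝ)|) ^ m) ^ 2) * (2 * (inner ℂ (β t k)
        (galerkinRHS S ν (fun k : ↥S => -((((σ (k : d → ℤ)) : ℝ) : ℂ) • β t k)) (β t) k)).re)) s t ∧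
    ∑ k : ↥S, (1 + ∑ i, ((2 * Real.pi * |((k : d → ℤ) i : ℝ)|) ^ m) ^ 2) * (2 * (inner ℂ (β t k)
        (galerkinRHS S ν (fun k : ↥S => -((((σ (k : d → ℤ)) : ℝ) : ℂ) • β t k)) (β t) k)).re) ≤
      Fintype.card d * (2 * (2 ^ m * (Fintype.card d * Real.sqrt B * (2 * Real.pi) ^ (2 * m + 1)) *
        (Real.sqrt (∑ k ∈ S, (1 + freqNormSq k) ^ (max 4 (m - 1)) * ‖coeffExt S (β t) k‖ ^ 2) *
          ∑ k ∈ S, (1 + freqNormSq k) ^ m * ‖coeffExt S (β t) k‖ ^ 2))) := by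
  refine ⟨hasDerivWithinAt_weightedEnergy h (fun k => 1 + ∑ i, ((2 * Real.pi * |(k i : ℝ)|) ^ m) ^ 2), ?_⟩
  -- split the weight into its `L²` part and its `#d` pure parts
  set X : ↥S → ℝ := fun k => 2 * (inner ℂ (β t k)
    (galerkinRHS S ν (fun k : ↥S => -((((σ (k : d → ℤ)) : ℝ) : ℂ) • β t k)) (β t) k)).re with hX
  have hsplit : ∑ k : ↥S, (1 + ∑ i, ((2 * Real.pi * |((k : d → ℤ) i : ℝ)|) ^ m) ^ 2) * X k =
      ∑ k : ↥S, (1 : ℝ) * X k + ∑ i, ∑ k : ↥S, ((2 * Real.pi * |((k : d → ℤ) i : ℝ)|) ^ m) ^ 2 * X k := by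
    rw [Finset.sum_comm, ← Finset.sum_add_distrib]
    refine Finset.sum_congr rfl fun k _ => ?_
    rw [add_mul, Finset.sum_mul]
  rw [hsplit]
  have h0 := energyPairing_le hS hν hσ hβ
  have hi : ∀ i, ∑ k : ↥S, ((2 * Real.pi * |((k : d → ℤ) i : ℝ)|) ^ m) ^ 2 * X k ≤
      2 * (2 ^ m * (Fintype.card d * Real.sqrt B * (2 * Real.pi) ^ (2 * m + 1)) *
        (Real.sqrt (∑ k ∈ S, (1 + freqNormSq k) ^ (max 4 (m - 1)) * ‖coeffExt S (β t) k‖ ^ 2) *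
          ∑ k ∈ S, (1 + freqNormSq k) ^ m * ‖coeffExt S (β t) k‖ ^ 2)) :=
    fun i => purePairing_le hS hν hσ hβ hB hm i
  have hsum := Finset.sum_le_sum fun i (_ : i ∈ (Finset.univ : Finset d)) => hi i
  rw [Finset.sum_const, Finset.card_univ, nsmul_eq_mul] at hsum
  linarith

/-- Auxiliary: the derivative within `[0, T]` at `x ∈ [0, T)` is a right derivative. [folklore] -/
theorem hasDerivWithinAt_Ici_of_Icc {f : ℝ → ℝ} {f' : ℝ} {T x : ℝ} (hx : x ∈ Ico 0 T)
    (h : HasDerivWithinAt f f' (Icc 0 T) x) : HasDerivWithinAt f f' (Ici x) x := by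
  have hmem : Icc 0 T ∈ 𝓝[Ici x] x :=
    mem_nhdsWithin.2 ⟨Iio T, isOpen_Iio, hx.2, fun z hz => ⟨hx.1.trans hz.2, hz.1.le⟩⟩
  exact h.mono_of_mem_nhdsWithin hmem

/-- **The comparison function of the `H⁴` estimate**: `b(s) = P₁ (1 - κs)⁻²` solves
`b' = 2κ P₁^{-1/2} · b √b`; here with `2κ = (L+1) √P₁`, so `b' = (L+1) b √b`. [folklore] -/
theorem hasDerivAt_blowupProfile {P₁ L s : ℝ} (hP₁ : 0 < P₁) (hs : (L + 1) * Real.sqrt P₁ / 2 * s < 1) :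
    HasDerivAt (fun y => P₁ * ((1 - (L + 1) * Real.sqrt P₁ / 2 * y) * (1 - (L + 1) * Real.sqrt P₁ / 2 * y))⁻¹)
      ((L + 1) * (P₁ * ((1 - (L + 1) * Real.sqrt P₁ / 2 * s) * (1 - (L + 1) * Real.sqrt P₁ / 2 * s))⁻¹) *
        Real.sqrt (P₁ * ((1 - (L + 1) * Real.sqrt P₁ / 2 * s) * (1 - (L + 1) * Real.sqrt P₁ / 2 * s))⁻¹)) s := by
  set κ := (L + 1) * Real.sqrt P₁ / 2 with hκ
  set g : ℝ → ℝ := fun y => 1 - κ * y with hg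
  have hgs : 0 < g s := by simp only [hg]; linarith
  have hg' : HasDerivAt g (-(κ * 1)) s := ((hasDerivAt_id s).const_mul κ).const_sub 1
  have hgg : HasDerivAt (fun y => g y * g y) (-(κ * 1) * g s + g s * -(κ * 1)) s := hg'.mul hg'
  have hinv := (hgg.inv (mul_pos hgs hgs).ne').const_mul P₁
  have hsqrt : Real.sqrt (P₁ * (g s * g s)⁻¹) = Real.sqrt P₁ * (g s)⁻¹ := by
    rw [Real.sqrt_mul hP₁.le, Real.sqrt_inv, Real.sqrt_mul_self hgs.le]
  have hval : P₁ * (-(-(κ * 1) * g s + g s * -(κ * 1)) / (g s * g s) ^ 2) =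
      (L + 1) * (P₁ * (g s * g s)⁻¹) * Real.sqrt (P₁ * (g s * g s)⁻¹) := by
    rw [hsqrt]
    have hP : Real.sqrt P₁ * Real.sqrt P₁ = P₁ := Real.mul_self_sqrt hP₁.le
    field_simp
    rw [hκ]
    nlinarith [hP, hgs]
  rw [hval] at hinv
  exact hinv

/-- **The short-time `H⁴` bound, uniform in the truncation and in the dissipation**
(Majda–Bertozzi 2002, Thm. 3.4 (ii) with (3.56) / Prop. 3.7 at `m = 4`, for the Fourier–Galerkin
system on `T^d` with viscosity `ν ≥ 0` and an extra nonnegative damping symbol `σ`). Let `β`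
solve `β' = V(-σβ, β)` on `[0, T]` in the Galerkin phase space, let
`P(τ) = ∑_k (1 + ∑ᵢ (2π|kᵢ|)⁸) ‖β τ k‖²` and `P(0) ≤ P₁`, `P₁ > 0`. With `A = (#d+1)³`,
`L = #d · 2 · 2⁴ #d √B (2π)⁹ · A √A`: if `T (L+1) √P₁ ≤ 1` then `P(t) ≤ 4P₁` on `[0, T]`
(comparison with `P₁ (1 - (L+1)√P₁ t/2)⁻²`, which solves `b' = (L+1) b √b > L b √b ≥ P'`).
[cite: MajdaBertozziCUP2002, Thm. 3.4 (ii), (3.55)–(3.56)] -/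
theorem pureEnergy_four_le (hS : ∀ k ∈ S, -k ∈ S) {ν : ℝ} (hν : 0 ≤ ν) {σ : (d → ℤ) → ℝ}
    (hσ : ∀ k, 0 ≤ σ k) {B : ℝ} (hB : ∑ k ∈ S, ((1 + freqNormSq k) ^ 2)⁻¹ ≤ B) {T : ℝ}
    {β : ℝ → ↥S → EuclideanSpace ℂ d}
    (hβ : ∀ t ∈ Icc 0 T, HasDerivWithinAt β
      (galerkinRHS S ν (fun k : ↥S => -((((σ (k : d → ℤ)) : ℝ) : ℂ) • β t k)) (β t)) (Icc 0 T) t)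
    (hmem : ∀ t ∈ Icc 0 T, β t ∈ galerkinSubspace S) {P₁ : ℝ} (hP₁ : 0 < P₁)
    (h0 : ∑ k : ↥S, (1 + ∑ i, ((2 * Real.pi * |((k : d → ℤ) i : ℝ)|) ^ 4) ^ 2) * ‖β 0 k‖ ^ 2 ≤ P₁)
    (hT : T * ((Fintype.card d * (2 * (2 ^ 4 * (Fintype.card d * Real.sqrt B * (2 * Real.pi) ^ (2 * 4 + 1)))) *
      (((Fintype.card d : ℝ) + 1) ^ 3 * Real.sqrt (((Fintype.card d : ℝ) + 1) ^ 3)) + 1) * Real.sqrt P₁) ≤ 1) :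
    ∀ t ∈ Icc 0 T, ∑ k : ↥S, (1 + ∑ i, ((2 * Real.pi * |((k : d → ℤ) i : ℝ)|) ^ 4) ^ 2) * ‖β t k‖ ^ 2 ≤
      4 * P₁ := by
  set A : ℝ := ((Fintype.card d : ℝ) + 1) ^ 3 with hA
  set K : ℝ := Fintype.card d * (2 * (2 ^ 4 * (Fintype.card d * Real.sqrt B * (2 * Real.pi) ^ (2 * 4 + 1))))
    with hK
  set L : ℝ := K * (A * Real.sqrt A) with hL
  set f : ℝ → ℝ := fun τ => ∑ k : ↥S, (1 + ∑ i, ((2 * Real.pi * |((k : d → ℤ) i : ℝ)|) ^ 4) ^ 2) * ‖β τ k‖ ^ 2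
    with hf
  set f' : ℝ → ℝ := fun τ => ∑ k : ↥S, (1 + ∑ i, ((2 * Real.pi * |((k : d → ℤ) i : ℝ)|) ^ 4) ^ 2) *
    (2 * (inner ℂ (β τ k) (galerkinRHS S ν (fun k : ↥S => -((((σ (k : d → ℤ)) : ℝ) : ℂ) • β τ k)) (β τ) k)).re)
    with hf'
  have hB0 : 0 ≤ B := le_trans (Finset.sum_nonneg fun k _ => inv_nonneg.2 (sq_nonneg _)) hB
  have hA1 : 1 ≤ A := by rw [hA]; exact one_le_pow₀ (by linarith [Nat.cast_nonneg (α := ℝ) (Fintype.card d)])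
  have hK0 : 0 ≤ K := by rw [hK]; positivity
  have hL0 : 0 ≤ L := by rw [hL]; positivity
  -- the differential inequality `f' ≤ L f √f`
  have hderiv : ∀ t ∈ Icc 0 T, HasDerivWithinAt f (f' t) (Icc 0 T) t ∧ f' t ≤ L * f t * Real.sqrt (f t) := by
    intro t ht
    obtain ⟨hd, hle⟩ := hasDerivWithinAt_pureEnergy hS hν hσ hB (le_refl 4) (hβ t ht) (hmem t ht)
    refine ⟨hd, hle.trans ?_⟩
    have hW4 := sobolevSum_le_pureEnergy (β t) (le_refl 4) (by norm_num : 1 ≤ 4)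
    have hWr := sobolevSum_le_pureEnergy (β t) (show max 4 (4 - 1) ≤ 4 by norm_num) (by norm_num : 1 ≤ 4)
    simp only [show (4 : ℕ) - 1 = 3 by norm_num] at hW4 hWr
    rw [← hA] at hW4 hWr
    have hf0 : 0 ≤ f t := Finset.sum_nonneg fun k _ => mul_nonneg (by positivity) (sq_nonneg _)
    have h1 : Real.sqrt (∑ k ∈ S, (1 + freqNormSq k) ^ (max 4 (4 - 1)) * ‖coeffExt S (β t) k‖ ^ 2) ≤
        Real.sqrt A * Real.sqrt (f t) := by
      rw [← Real.sqrt_mul (by positivity)]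
      exact Real.sqrt_le_sqrt hWr
    have h2 : ∑ k ∈ S, (1 + freqNormSq k) ^ 4 * ‖coeffExt S (β t) k‖ ^ 2 ≤ A * f t := hW4
    have hW0 : 0 ≤ ∑ k ∈ S, (1 + freqNormSq k) ^ 4 * ‖coeffExt S (β t) k‖ ^ 2 :=
      Finset.sum_nonneg fun k _ => mul_nonneg (pow_nonneg (by linarith [freqNormSq_nonneg k]) _) (sq_nonneg _)
    calc Fintype.card d * (2 * (2 ^ 4 * (Fintype.card d * Real.sqrt B * (2 * Real.pi) ^ (2 * 4 + 1)) *
          (Real.sqrt (∑ k ∈ S, (1 + freqNormSq k) ^ (max 4 (4 - 1)) * ‖coeffExt S (β t) k‖ ^ 2) *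
            ∑ k ∈ S, (1 + freqNormSq k) ^ 4 * ‖coeffExt S (β t) k‖ ^ 2)))
        = K * (Real.sqrt (∑ k ∈ S, (1 + freqNormSq k) ^ (max 4 (4 - 1)) * ‖coeffExt S (β t) k‖ ^ 2) *
            ∑ k ∈ S, (1 + freqNormSq k) ^ 4 * ‖coeffExt S (β t) k‖ ^ 2) := by rw [hK]; ring
      _ ≤ K * ((Real.sqrt A * Real.sqrt (f t)) * (A * f t)) :=
          mul_le_mul_of_nonneg_left (mul_le_mul h1 h2 hW0 (by positivity)) hK0
      _ = L * f t * Real.sqrt (f t) := by rw [hL]; ring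
  have hcont : ContinuousOn f (Icc 0 T) := fun t ht => (hderiv t ht).1.continuousWithinAt
  intro t ht
  -- comparison on `[0, t]`
  set κ : ℝ := (L + 1) * Real.sqrt P₁ / 2 with hκ
  have hκ0 : 0 ≤ κ := by rw [hκ]; positivity
  have hκt : κ * t ≤ 1 / 2 := by
    have h1 : t * ((L + 1) * Real.sqrt P₁) ≤ 1 :=
      le_trans (mul_le_mul_of_nonneg_right ht.2 (by positivity)) hT
    rw [hκ]; nlinarith
  set b : ℝ → ℝ := fun y => P₁ * ((1 - κ * y) * (1 - κ * y))⁻¹ with hb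
  set b' : ℝ → ℝ := fun y => (L + 1) * b y * Real.sqrt (b y) with hb'
  have hg : ∀ y ∈ Icc 0 t, 1 / 2 ≤ 1 - κ * y := by
    intro y hy
    have : κ * y ≤ κ * t := mul_le_mul_of_nonneg_left hy.2 hκ0
    linarith
  have hbd : ∀ y ∈ Icc 0 t, HasDerivAt b (b' y) y := by
    intro y hy
    have hy1 : (L + 1) * Real.sqrt P₁ / 2 * y < 1 := by
      have := hg y hy; rw [hκ] at this; linarith
    exact hasDerivAt_blowupProfile hP₁ hy1
  have hbpos : ∀ y ∈ Icc 0 t, P₁ ≤ b y := by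
    intro y hy
    have hgy := hg y hy
    have hg1 : (1 - κ * y) * (1 - κ * y) ≤ 1 := by
      have : 1 - κ * y ≤ 1 := by nlinarith [hy.1]
      nlinarith
    have hgpos : 0 < (1 - κ * y) * (1 - κ * y) := by nlinarith
    calc P₁ = P₁ * 1 := (mul_one _).symm
      _ ≤ P₁ * ((1 - κ * y) * (1 - κ * y))⁻¹ :=
          mul_le_mul_of_nonneg_left (one_le_inv_iff₀.2 ⟨hgpos, hg1⟩) hP₁.le
  have hcomp := image_le_of_deriv_right_lt_deriv_boundary' (f := f) (f' := f') (a := 0) (b := t)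
    (hcont.mono (Icc_subset_Icc le_rfl ht.2))
    (fun y hy => hasDerivWithinAt_Ici_of_Icc ⟨hy.1, hy.2.trans_le ht.2⟩
      (hderiv y ⟨hy.1, hy.2.le.trans ht.2⟩).1)
    (B := b) (B' := b') (by simp only [hb, mul_zero, sub_zero, mul_one, inv_one]; exact h0)
    (fun y hy => (hbd y hy).continuousAt.continuousWithinAt)
    (fun y hy => (hbd y (Ico_subset_Icc_self hy)).hasDerivWithinAt)
    (fun y hy hfy => by
      have hyT : y ∈ Icc 0 T := ⟨hy.1, hy.2.le.trans ht.2⟩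
      have hle := (hderiv y hyT).2
      rw [hfy] at hle
      have hby : 0 < b y := hP₁.trans_le (hbpos y (Ico_subset_Icc_self hy))
      have hbs : 0 < b y * Real.sqrt (b y) := mul_pos hby (Real.sqrt_pos.2 hby)
      calc f' y ≤ L * b y * Real.sqrt (b y) := hle
        _ < (L + 1) * b y * Real.sqrt (b y) := by nlinarith)
  have hft : f t ≤ b t := hcomp (right_mem_Icc.2 ht.1)
  refine hft.trans ?_
  -- `b t ≤ 4 P₁`
  have hgt := hg t (right_mem_Icc.2 ht.1)
  have h4 : ((1 - κ * t) * (1 - κ * t))⁻¹ ≤ 4 := by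
    rw [inv_le_comm₀ (by nlinarith) (by norm_num)]
    nlinarith
  calc b t = P₁ * ((1 - κ * t) * (1 - κ * t))⁻¹ := rfl
    _ ≤ P₁ * 4 := mul_le_mul_of_nonneg_left h4 hP₁.le
    _ = 4 * P₁ := mul_comm _ _

/-- **Linear propagation of the higher energies** (Majda–Bertozzi 2002, (3.79): once a lower norm
is controlled, the `H^m` energy grows at most exponentially). Let `β` solve the damped Galerkin
system on `[0, T]`, `m ≥ 4`, and suppose `W_r(t) ≤ R` on `[0, T]`, `r = max 4 (m-1)`. Then
`P_m(t) ≤ P₁ exp(L_m √R t)` whenever `P_m(0) ≤ P₁`, with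
`L_m = #d · 2 · 2ᵐ #d √B (2π)^{2m+1} · (#d+1)^{m-1}` (Grönwall). [cite: MajdaBertozziCUP2002, Thm. 3.5 proof, (3.79)] -/
theorem pureEnergy_le_exp (hS : ∀ k ∈ S, -k ∈ S) {ν : ℝ} (hν : 0 ≤ ν) {σ : (d → ℤ) → ℝ}
    (hσ : ∀ k, 0 ≤ σ k) {B : ℝ} (hB : ∑ k ∈ S, ((1 + freqNormSq k) ^ 2)⁻¹ ≤ B) {m : ℕ} (hm : 4 ≤ m)
    {T : ℝ} {β : ℝ → ↥S → EuclideanSpace ℂ d}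
    (hβ : ∀ t ∈ Icc 0 T, HasDerivWithinAt β
      (galerkinRHS S ν (fun k : ↥S => -((((σ (k : d → ℤ)) : ℝ) : ℂ) • β t k)) (β t)) (Icc 0 T) t)
    (hmem : ∀ t ∈ Icc 0 T, β t ∈ galerkinSubspace S) {R : ℝ}
    (hR : ∀ t ∈ Icc 0 T, ∑ k ∈ S, (1 + freqNormSq k) ^ (max 4 (m - 1)) * ‖coeffExt S (β t) k‖ ^ 2 ≤ R)
    {P₁ : ℝ} (h0 : ∑ k : ↥S, (1 + ∑ i, ((2 * Real.pi * |((k : d → ℤ) i : ℝ)|) ^ m) ^ 2) * ‖β 0 k‖ ^ 2 ≤ P₁) :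
    ∀ t ∈ Icc 0 T, ∑ k : ↥S, (1 + ∑ i, ((2 * Real.pi * |((k : d → ℤ) i : ℝ)|) ^ m) ^ 2) * ‖β t k‖ ^ 2 ≤
      P₁ * Real.exp ((Fintype.card d * (2 * (2 ^ m * (Fintype.card d * Real.sqrt B * (2 * Real.pi) ^ (2 * m + 1)))) *
        ((Fintype.card d : ℝ) + 1) ^ (m - 1) * Real.sqrt R) * t) := by
  set A : ℝ := ((Fintype.card d : ℝ) + 1) ^ (m - 1) with hA
  set K : ℝ := Fintype.card d * (2 * (2 ^ m * (Fintype.card d * Real.sqrt B * (2 * Real.pi) ^ (2 * m + 1))))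
    with hK
  set f : ℝ → ℝ := fun τ => ∑ k : ↥S, (1 + ∑ i, ((2 * Real.pi * |((k : d → ℤ) i : ℝ)|) ^ m) ^ 2) * ‖β τ k‖ ^ 2
    with hf
  set f' : ℝ → ℝ := fun τ => ∑ k : ↥S, (1 + ∑ i, ((2 * Real.pi * |((k : d → ℤ) i : ℝ)|) ^ m) ^ 2) *
    (2 * (inner ℂ (β τ k) (galerkinRHS S ν (fun k : ↥S => -((((σ (k : d → ℤ)) : ℝ) : ℂ) • β τ k)) (β τ) k)).re)
    with hf'
  have hB0 : 0 ≤ B := le_trans (Finset.sum_nonneg fun k _ => inv_nonneg.2 (sq_nonneg _)) hB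
  have hK0 : 0 ≤ K := by rw [hK]; positivity
  have hm1 : 1 ≤ m := le_trans (by norm_num) hm
  -- the linear differential inequality `f' ≤ (K A √R) f`
  have hderiv : ∀ t ∈ Icc 0 T, HasDerivWithinAt f (f' t) (Icc 0 T) t ∧ f' t ≤ K * A * Real.sqrt R * f t + 0 := by
    intro t ht
    obtain ⟨hd, hle⟩ := hasDerivWithinAt_pureEnergy hS hν hσ hB hm (hβ t ht) (hmem t ht)
    refine ⟨hd, hle.trans ?_⟩
    rw [add_zero]
    have hWm := sobolevSum_le_pureEnergy (β t) (le_refl m) hm1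
    rw [← hA] at hWm
    have hf0 : 0 ≤ f t := Finset.sum_nonneg fun k _ => mul_nonneg (by positivity) (sq_nonneg _)
    have h1 : Real.sqrt (∑ k ∈ S, (1 + freqNormSq k) ^ (max 4 (m - 1)) * ‖coeffExt S (β t) k‖ ^ 2) ≤
        Real.sqrt R := Real.sqrt_le_sqrt (hR t ht)
    have hW0 : 0 ≤ ∑ k ∈ S, (1 + freqNormSq k) ^ m * ‖coeffExt S (β t) k‖ ^ 2 :=
      Finset.sum_nonneg fun k _ => mul_nonneg (pow_nonneg (by linarith [freqNormSq_nonneg k]) _) (sq_nonneg _)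
    calc Fintype.card d * (2 * (2 ^ m * (Fintype.card d * Real.sqrt B * (2 * Real.pi) ^ (2 * m + 1)) *
          (Real.sqrt (∑ k ∈ S, (1 + freqNormSq k) ^ (max 4 (m - 1)) * ‖coeffExt S (β t) k‖ ^ 2) *
            ∑ k ∈ S, (1 + freqNormSq k) ^ m * ‖coeffExt S (β t) k‖ ^ 2)))
        = K * (Real.sqrt (∑ k ∈ S, (1 + freqNormSq k) ^ (max 4 (m - 1)) * ‖coeffExt S (β t) k‖ ^ 2) *
            ∑ k ∈ S, (1 + freqNormSq k) ^ m * ‖coeffExt S (β t) k‖ ^ 2) := by rw [hK]; ring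
      _ ≤ K * (Real.sqrt R * (A * f t)) :=
          mul_le_mul_of_nonneg_left (mul_le_mul h1 hWm hW0 (Real.sqrt_nonneg _)) hK0
      _ = K * A * Real.sqrt R * f t := by ring
  have hcont : ContinuousOn f (Icc 0 T) := fun t ht => (hderiv t ht).1.continuousWithinAt
  have hgron := le_gronwallBound_of_liminf_deriv_right_le (f := f) (f' := f') (δ := P₁)
    (K := K * A * Real.sqrt R) (ε := 0) (a := 0) (b := T) hcont
    (fun x hx r hr => (hasDerivWithinAt_Ici_of_Icc hx (hderiv x (Ico_subset_Icc_self hx)).1).liminf_right_slope_le hr)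
    h0 (fun x hx => (hderiv x (Ico_subset_Icc_self hx)).2)
  intro t ht
  have h := hgron t ht
  rw [gronwallBound_ε0, sub_zero] at h
  calc f t ≤ P₁ * Real.exp (K * A * Real.sqrt R * t) := h
    _ = _ := by rw [hK, hA]

/-- **Uniform Sobolev bounds of all orders on the `H⁴` life span** (Majda–Bertozzi 2002,
Thm. 3.4/3.5 with the remark after (3.79): on the interval of existence determined by a *fixed*
high norm of the datum, every `H^m` norm stays bounded in terms of the `H^m` norm of the datum).
For every `m ≥ 4` there is a function `Φ_m(M, x)` (depending only on `d`, `B`, `m`; monotone and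
nonnegative in `x` for `M > 0`) such that for every finite symmetric `S` with
`∑_{k∈S} ((1+|k|²)²)⁻¹ ≤ B`, all `ν ≥ 0`, `σ ≥ 0`, every solution `β` of the damped Galerkin
system on `[0, T]` in the Galerkin phase space, and every `M > 0` with
`W₄(0) = ∑_{k∈S} (1+|k|²)⁴ ‖β̄ 0 k‖² ≤ M` and `T · c(d,B) √M ≤ 1`:
`W_m(t) ≤ Φ_m(M, W_m(0))` on `[0, T]` — uniformly in `S`, `ν`, `σ`. (`c(d,B) = (L+1)√(1 + #d(2π)⁸)`
with the `L` of `pureEnergy_four_le`.) [cite: MajdaBertozziCUP2002, Thm. 3.4, Thm. 3.5, (3.79)] -/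
theorem sobolev_bounds_allOrders (B : ℝ) :
    ∀ m : ℕ, 4 ≤ m → ∃ Φ : ℝ → ℝ → ℝ, (∀ M, 0 < M → Monotone (Φ M)) ∧ (∀ M, 0 < M → ∀ x, 0 ≤ Φ M x) ∧
      ∀ (S : Finset (d → ℤ)), (∀ k ∈ S, -k ∈ S) → ∑ k ∈ S, ((1 + freqNormSq k) ^ 2)⁻¹ ≤ B →
      ∀ (ν : ℝ), 0 ≤ ν → ∀ (σ : (d → ℤ) → ℝ), (∀ k, 0 ≤ σ k) →
      ∀ (T : ℝ) (β : ℝ → ↥S → EuclideanSpace ℂ d),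
        (∀ t ∈ Icc 0 T, HasDerivWithinAt β
          (galerkinRHS S ν (fun k : ↥S => -((((σ (k : d → ℤ)) : ℝ) : ℂ) • β t k)) (β t)) (Icc 0 T) t) →
        (∀ t ∈ Icc 0 T, β t ∈ galerkinSubspace S) →
      ∀ (M : ℝ), 0 < M → ∑ k ∈ S, (1 + freqNormSq k) ^ 4 * ‖coeffExt S (β 0) k‖ ^ 2 ≤ M →
        T * (((Fintype.card d * (2 * (2 ^ 4 * (Fintype.card d * Real.sqrt B * (2 * Real.pi) ^ (2 * 4 + 1)))) *
          (((Fintype.card d : ℝ) + 1) ^ 3 * Real.sqrt (((Fintype.card d : ℝ) + 1) ^ 3)) + 1) *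
          Real.sqrt (1 + Fintype.card d * (2 * Real.pi) ^ (2 * 4))) * Real.sqrt M) ≤ 1 →
      ∀ t ∈ Icc 0 T, ∑ k ∈ S, (1 + freqNormSq k) ^ m * ‖coeffExt S (β t) k‖ ^ 2 ≤
        Φ M (∑ k ∈ S, (1 + freqNormSq k) ^ m * ‖coeffExt S (β 0) k‖ ^ 2) := by
  -- the life-span constant
  set cL : ℝ := ((Fintype.card d * (2 * (2 ^ 4 * (Fintype.card d * Real.sqrt B * (2 * Real.pi) ^ (2 * 4 + 1)))) *
    (((Fintype.card d : ℝ) + 1) ^ 3 * Real.sqrt (((Fintype.card d : ℝ) + 1) ^ 3)) + 1) *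
    Real.sqrt (1 + Fintype.card d * (2 * Real.pi) ^ (2 * 4))) with hcL
  refine Nat.le_induction ?_ ?_
  · -- `m = 4`
    refine ⟨fun M _ => 4 * ((Fintype.card d : ℝ) + 1) ^ 3 * ((1 + Fintype.card d * (2 * Real.pi) ^ (2 * 4)) * M),
      fun M _ => monotone_const, fun M hM x => by positivity, ?_⟩
    intro S hS hB ν hν σ hσ T β hβ hmem M hM h4 hT t ht
    have hB0 : 0 ≤ B := le_trans (Finset.sum_nonneg fun k _ => inv_nonneg.2 (sq_nonneg _)) hB
    set P₁ : ℝ := (1 + Fintype.card d * (2 * Real.pi) ^ (2 * 4)) * M with hP₁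
    have hP₁pos : 0 < P₁ := by rw [hP₁]; positivity
    have h0 : ∑ k : ↥S, (1 + ∑ i, ((2 * Real.pi * |((k : d → ℤ) i : ℝ)|) ^ 4) ^ 2) * ‖β 0 k‖ ^ 2 ≤ P₁ :=
      (pureEnergy_le_sobolevSum (β 0) 4).trans (mul_le_mul_of_nonneg_left h4 (by positivity))
    have hsq : Real.sqrt P₁ = Real.sqrt (1 + Fintype.card d * (2 * Real.pi) ^ (2 * 4)) * Real.sqrt M := by
      rw [hP₁, Real.sqrt_mul (by positivity)]
    have hT' : T * ((Fintype.card d * (2 * (2 ^ 4 * (Fintype.card d * Real.sqrt B * (2 * Real.pi) ^ (2 * 4 + 1)))) *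
        (((Fintype.card d : ℝ) + 1) ^ 3 * Real.sqrt (((Fintype.card d : ℝ) + 1) ^ 3)) + 1) * Real.sqrt P₁) ≤ 1 := by
      rw [hsq]; convert hT using 1; rw [hcL]; ring
    have hP := pureEnergy_four_le hS hν hσ hB hβ hmem hP₁pos h0 hT' t ht
    have hW := sobolevSum_le_pureEnergy (β t) (le_refl 4) (by norm_num : 1 ≤ 4)
    simp only [show (4 : ℕ) - 1 = 3 by norm_num] at hW
    calc ∑ k ∈ S, (1 + freqNormSq k) ^ 4 * ‖coeffExt S (β t) k‖ ^ 2
        ≤ ((Fintype.card d : ℝ) + 1) ^ 3 * (4 * P₁) := hW.trans (mul_le_mul_of_nonneg_left hP (by positivity))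
      _ = 4 * ((Fintype.card d : ℝ) + 1) ^ 3 * ((1 + Fintype.card d * (2 * Real.pi) ^ (2 * 4)) * M) := by
          rw [hP₁]; ring
  · -- `m → m + 1`
    intro m hm IH
    obtain ⟨Φ, hΦmono, hΦnn, hΦ⟩ := IH
    set A : ℝ := ((Fintype.card d : ℝ) + 1) ^ (m + 1 - 1) with hA
    set K : ℝ := Fintype.card d * (2 * (2 ^ (m + 1) * (Fintype.card d * Real.sqrt B * (2 * Real.pi) ^ (2 * (m + 1) + 1))))
      with hK
    set E : ℝ := 1 + Fintype.card d * (2 * Real.pi) ^ (2 * (m + 1)) with hE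
    refine ⟨fun M x => A * (E * max x 0) * Real.exp (K * A * Real.sqrt (Φ M x) * (cL * Real.sqrt M)⁻¹),
      ?_, ?_, ?_⟩
    · -- monotone
      intro M hM
      have hB' : 0 ≤ Real.sqrt B := Real.sqrt_nonneg _
      have hcL0 : 0 ≤ cL := by rw [hcL]; positivity
      have hcoef : 0 ≤ K * A * (cL * Real.sqrt M)⁻¹ := by rw [hK, hA]; positivity
      refine Monotone.mul ?_ ?_ (fun x => by rw [hA, hE]; positivity) (fun x => (Real.exp_pos _).le)
      · exact fun x y hxy => mul_le_mul_of_nonneg_left (mul_le_mul_of_nonneg_left (max_le_max hxy le_rfl)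
          (by rw [hE]; positivity)) (by rw [hA]; positivity)
      · intro x y hxy
        refine Real.exp_le_exp.2 ?_
        have h1 : Real.sqrt (Φ M x) ≤ Real.sqrt (Φ M y) := Real.sqrt_le_sqrt (hΦmono M hM hxy)
        calc K * A * Real.sqrt (Φ M x) * (cL * Real.sqrt M)⁻¹
            = K * A * (cL * Real.sqrt M)⁻¹ * Real.sqrt (Φ M x) := by ring
          _ ≤ K * A * (cL * Real.sqrt M)⁻¹ * Real.sqrt (Φ M y) := mul_le_mul_of_nonneg_left h1 hcoef
          _ = K * A * Real.sqrt (Φ M y) * (cL * Real.sqrt M)⁻¹ := by ring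
    · intro M hM x
      have hB' : 0 ≤ Real.sqrt B := Real.sqrt_nonneg _
      rw [hA, hE]; positivity
    intro S hS hB ν hν σ hσ T β hβ hmem M hM h4 hT t ht
    have hB0 : 0 ≤ B := le_trans (Finset.sum_nonneg fun k _ => inv_nonneg.2 (sq_nonneg _)) hB
    have hcLpos : 0 < cL := by rw [hcL]; positivity
    -- the lower-order bound from the induction hypothesis
    set R : ℝ := Φ M (∑ k ∈ S, (1 + freqNormSq k) ^ (m + 1) * ‖coeffExt S (β 0) k‖ ^ 2) with hR
    have hRt : ∀ s ∈ Icc 0 T, ∑ k ∈ S, (1 + freqNormSq k) ^ (max 4 (m + 1 - 1)) * ‖coeffExt S (β s) k‖ ^ 2 ≤ R := by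
      intro s hs
      rw [show max 4 (m + 1 - 1) = m by omega]
      refine (hΦ S hS hB ν hν σ hσ T β hβ hmem M hM h4 hT s hs).trans ?_
      exact hΦmono M hM (sum_weight_pow_mul_norm_sq_mono S (coeffExt S (β 0)) (Nat.le_succ m))
    -- Grönwall at order `m + 1`
    set W0 : ℝ := ∑ k ∈ S, (1 + freqNormSq k) ^ (m + 1) * ‖coeffExt S (β 0) k‖ ^ 2 with hW0
    have hW0nn : 0 ≤ W0 := Finset.sum_nonneg fun k _ =>
      mul_nonneg (pow_nonneg (by linarith [freqNormSq_nonneg k]) _) (sq_nonneg _)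
    have h0 : ∑ k : ↥S, (1 + ∑ i, ((2 * Real.pi * |((k : d → ℤ) i : ℝ)|) ^ (m + 1)) ^ 2) * ‖β 0 k‖ ^ 2 ≤ E * W0 :=
      pureEnergy_le_sobolevSum (β 0) (m + 1)
    have hexp := pureEnergy_le_exp hS hν hσ hB (le_trans hm (Nat.le_succ m)) hβ hmem hRt h0 t ht
    have hWt := sobolevSum_le_pureEnergy (β t) (le_refl (m + 1)) (by omega : 1 ≤ m + 1)
    rw [← hA] at hWt
    -- `t ≤ T ≤ 1/(cL √M)`
    have htT : t * (cL * Real.sqrt M) ≤ 1 := le_trans (mul_le_mul_of_nonneg_right ht.2 (by positivity)) hT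
    have hcM : 0 < cL * Real.sqrt M := mul_pos hcLpos (Real.sqrt_pos.2 hM)
    have ht1 : t ≤ (cL * Real.sqrt M)⁻¹ := by
      rw [inv_eq_one_div, le_div_iff₀ hcM]; exact htT
    have hKA : 0 ≤ K * A * Real.sqrt R := by rw [hK, hA]; positivity
    have hexp_le : Real.exp (K * A * Real.sqrt R * t) ≤ Real.exp (K * A * Real.sqrt R * (cL * Real.sqrt M)⁻¹) :=
      Real.exp_le_exp.2 (mul_le_mul_of_nonneg_left ht1 hKA)
    calc ∑ k ∈ S, (1 + freqNormSq k) ^ (m + 1) * ‖coeffExt S (β t) k‖ ^ 2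
        ≤ A * ((E * W0) * Real.exp (K * A * Real.sqrt R * t)) := by
          refine hWt.trans (mul_le_mul_of_nonneg_left ?_ (by rw [hA]; positivity))
          convert hexp using 2
      _ ≤ A * ((E * W0) * Real.exp (K * A * Real.sqrt R * (cL * Real.sqrt M)⁻¹)) := by
          refine mul_le_mul_of_nonneg_left (mul_le_mul_of_nonneg_left hexp_le ?_) (by rw [hA]; positivity)
          rw [hE]; positivity
      _ = A * (E * max W0 0) * Real.exp (K * A * Real.sqrt (Φ M W0) * (cL * Real.sqrt M)⁻¹) := by
          rw [max_eq_left hW0nn, hR]; ring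

end Solution

/-! ## Global solutions of the damped Galerkin system -/

section Existence

variable {S : Finset (d → ℤ)}

omit [Fintype d] [DecidableEq d] in
/-- The damping force is linear: differences. [folklore] -/
theorem dampForce_sub (σ : (d → ℤ) → ℝ) (c c' : ↥S → EuclideanSpace ℂ d) :
    (fun k : ↥S => -((((σ (k : d → ℤ)) : ℝ) : ℂ) • c k)) -
        (fun k : ↥S => -((((σ (k : d → ℤ)) : ℝ) : ℂ) • c' k)) =
      (fun k : ↥S => -((((σ (k : d → ℤ)) : ℝ) : ℂ) • (c - c') k)) := by
  funext k
  simp only [Pi.sub_apply, smul_sub]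
  abel

omit [DecidableEq d] in
/-- Sup-norm bound of the damping force: `‖-σ • c‖ ≤ (∑_{k∈S} σ k) ‖c‖` for `σ ≥ 0`. [folklore] -/
theorem norm_dampForce_le {σ : (d → ℤ) → ℝ} (hσ : ∀ k, 0 ≤ σ k) (c : ↥S → EuclideanSpace ℂ d) :
    ‖(fun k : ↥S => -((((σ (k : d → ℤ)) : ℝ) : ℂ) • c k))‖ ≤ (∑ k' ∈ S, σ k') * ‖c‖ := by
  have hΛ : 0 ≤ ∑ k' ∈ S, σ k' := Finset.sum_nonneg fun k' _ => hσ k'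
  refine (pi_norm_le_iff_of_nonneg (by positivity)).2 fun k => ?_
  rw [norm_neg, norm_smul, Complex.norm_real, Real.norm_of_nonneg (hσ _)]
  exact mul_le_mul (Finset.single_le_sum (f := σ) (fun k' _ => hσ k') k.2) (norm_le_pi_norm c k)
    (norm_nonneg _) hΛ

omit [Fintype d] [DecidableEq d] in
/-- The damping force of a real coefficient vector is real when the symbol is even. [folklore] -/
theorem _root_.Literature.Analysis.FunctionSpaces.Torus.IsRealCoeff.dampForce {σ : (d → ℤ) → ℝ}
    (hσe : ∀ k, σ (-k) = σ k) {c : ↥S → EuclideanSpace ℂ d} (hc : IsRealCoeff c) :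
    IsRealCoeff (fun k : ↥S => -((((σ (k : d → ℤ)) : ℝ) : ℂ) • c k)) := by
  intro k l h
  dsimp only
  rw [hc k l h, h, hσe, FunctionSpaces.EuclideanSpace.conjVec_neg,
    FunctionSpaces.EuclideanSpace.conjVec_smul, Complex.conj_ofReal]

omit [DecidableEq d] in
/-- The damping force depends continuously (linearly) on the state. [folklore] -/
theorem continuous_dampForce (σ : (d → ℤ) → ℝ) :
    Continuous fun (c : ↥S → EuclideanSpace ℂ d) (k : ↥S) => -((((σ (k : d → ℤ)) : ℝ) : ℂ) • c k) :=
  continuous_pi fun k =>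
    (((continuous_apply k).const_smul (((σ (k : d → ℤ)) : ℝ) : ℂ)).neg :
      Continuous fun c : ↥S → EuclideanSpace ℂ d => -((((σ (k : d → ℤ)) : ℝ) : ℂ) • c k))

omit [DecidableEq d] in
/-- **Local Lipschitz bound** of the damped Galerkin field on the ball `‖c‖ ≤ ρ`. [folklore] -/
theorem norm_dampedGalerkinRHS_sub_le (ν : ℝ) {σ : (d → ℤ) → ℝ} (hσ : ∀ k, 0 ≤ σ k) {ρ : ℝ}
    {c c' : ↥S → EuclideanSpace ℂ d} (hc : ‖c‖ ≤ ρ) (hc' : ‖c'‖ ≤ ρ) :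
    ‖galerkinRHS S ν (fun k : ↥S => -((((σ (k : d → ℤ)) : ℝ) : ℂ) • c k)) c -
        galerkinRHS S ν (fun k : ↥S => -((((σ (k : d → ℤ)) : ℝ) : ℂ) • c' k)) c'‖ ≤
      ((‖ν‖ * (4 * Real.pi ^ 2 * ∑ k ∈ S, freqNormSq k) +
        2 * (2 * Real.pi * (S.card * ∑ m ∈ S, ∑ j, |(m j : ℝ)|) * ρ)) +
        ∑ k' ∈ S, σ k') * ‖c - c'‖ := by
  set g : (↥S → EuclideanSpace ℂ d) → ↥S → EuclideanSpace ℂ d :=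
    fun c k => -((((σ (k : d → ℤ)) : ℝ) : ℂ) • c k) with hg
  have h1 := norm_galerkinRHS_sub_le (S := S) ν (g c) hc hc'
  have h2 := norm_galerkinRHS_sub_galerkinRHS_le (S := S) ν (g c) (g c') c'
  have h23 : ‖galerkinRHS S ν (g c) c' - galerkinRHS S ν (g c') c'‖ ≤ (∑ k' ∈ S, σ k') * ‖c - c'‖ := by
    refine h2.trans ?_
    rw [hg, dampForce_sub]
    exact norm_dampForce_le (S := S) hσ (c - c')
  calc ‖galerkinRHS S ν (g c) c - galerkinRHS S ν (g c') c'‖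
      ≤ ‖galerkinRHS S ν (g c) c - galerkinRHS S ν (g c) c'‖ +
          ‖galerkinRHS S ν (g c) c' - galerkinRHS S ν (g c') c'‖ :=
        norm_sub_le_norm_sub_add_norm_sub _ _ _
    _ ≤ _ := by
        rw [add_mul]
        exact add_le_add h1 h23

/-- **Global existence for the damped Galerkin system** (Robinson–Rodrigo–Sadowski 2016, Thm. 4.4
Step 1 for `ν ≥ 0`; CDLDR 2018, §9 for the fractional damping): for a finite symmetric frequency
set `S`, viscosity `ν ≥ 0`, an even nonnegative damping symbol `σ` and a real divergence-free datum
`c₀`, the system `β' = V(-σβ, β)` has a solution `β : ℝ → (S → ℂ^d)` with `β 0 = c₀`, values in the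
Galerkin phase space, continuous, solving the equation on every `[0, T]` (one-sided derivatives at
the endpoints). Proof: `ODE.exists_solution_of_apriori_bound`, the a priori bound being the
monotonicity of the energy (`energyPairing_le`). [cite: RobinsonRodrigoSadowski2016, Thm. 4.4 Step 1] -/
theorem exists_dampedGalerkin_solution (hS : ∀ k ∈ S, -k ∈ S) {ν : ℝ} (hν : 0 ≤ ν)
    {σ : (d → ℤ) → ℝ} (hσ : ∀ k, 0 ≤ σ k) (hσe : ∀ k, σ (-k) = σ k)
    {c₀ : ↥S → EuclideanSpace ℂ d} (hc₀ : c₀ ∈ galerkinSubspace S) :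
    ∃ β : ℝ → ↥S → EuclideanSpace ℂ d, β 0 = c₀ ∧ (∀ t, β t ∈ galerkinSubspace S) ∧
      Continuous β ∧
      ∀ T, ∀ t ∈ Icc 0 T, HasDerivWithinAt β
        (galerkinRHS S ν (fun k : ↥S => -((((σ (k : d → ℤ)) : ℝ) : ℂ) • β t k)) (β t)) (Icc 0 T) t := by
  set Y := galerkinSubspace S with hY
  set W : (↥S → EuclideanSpace ℂ d) → ↥S → EuclideanSpace ℂ d :=
    fun c => galerkinRHS S ν (fun k : ↥S => -((((σ (k : d → ℤ)) : ℝ) : ℂ) • c k)) c with hW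
  have hWmem : ∀ c : Y, W c ∈ Y := fun c => galerkinRHS_mem ν hS (c.2.1.dampForce hσe) c.2
  set V : ℝ → Y → Y := fun _ c => ⟨W c, hWmem c⟩ with hV
  have hVcoe : ∀ t (c : Y), ((V t c : Y) : ↥S → EuclideanSpace ℂ d) = W c := fun t c => rfl
  -- Lipschitz on balls
  have hlip : ∀ T ρ : ℝ, ∃ K : ℝ≥0, ∀ t ∈ Icc 0 T, LipschitzOnWith K (V t) (closedBall 0 ρ) := by
    intro T ρ
    refine ⟨Real.toNNReal (((‖ν‖ * (4 * Real.pi ^ 2 * ∑ k ∈ S, freqNormSq k) +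
        2 * (2 * Real.pi * (S.card * ∑ m ∈ S, ∑ j, |(m j : ℝ)|) * ρ)) + ∑ k' ∈ S, σ k')), fun t _ => ?_⟩
    refine LipschitzOnWith.of_dist_le_mul fun c hc c' hc' => ?_
    rw [mem_closedBall, dist_zero_right] at hc hc'
    rw [Subtype.dist_eq, dist_eq_norm, dist_eq_norm, hVcoe t c, hVcoe t c']
    have h := norm_dampedGalerkinRHS_sub_le (S := S) ν hσ (ρ := ρ) (c := (c : ↥S → EuclideanSpace ℂ d))
      (c' := (c' : ↥S → EuclideanSpace ℂ d)) (by simpa using hc) (by simpa using hc')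
    exact h.trans (mul_le_mul_of_nonneg_right (Real.le_coe_toNNReal _) (norm_nonneg _))
  have hcont : ∀ c : Y, ContinuousOn (V · c) (Ici 0) := fun c => continuousOn_const
  -- a priori bound: the energy is non-increasing
  have hapriori : ∀ T : ℝ, 0 ≤ T → ∃ R : ℝ, ‖(⟨c₀, hc₀⟩ : Y)‖ ≤ R ∧
      ∀ s ∈ Icc 0 T, ∀ γ : ℝ → Y, γ 0 = ⟨c₀, hc₀⟩ →
        (∀ t ∈ Icc 0 s, HasDerivWithinAt γ (V t (γ t)) (Icc 0 s) t) →
        ∀ t ∈ Icc 0 s, ‖γ t‖ ≤ R := by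
    intro T _
    refine ⟨Real.sqrt (∑ k, ‖c₀ k‖ ^ 2), ?_, ?_⟩
    · change ‖c₀‖ ≤ _
      exact norm_le_sqrt_sum_norm_sq c₀
    · intro s _ γ hγ0 hγ t ht
      set β : ℝ → ↥S → EuclideanSpace ℂ d := fun τ => (γ τ : ↥S → EuclideanSpace ℂ d) with hβ
      have hβ' : ∀ τ ∈ Icc 0 s, HasDerivWithinAt β (W (β τ)) (Icc 0 s) τ := by
        intro τ hτ
        exact Y.subtypeL.hasFDerivAt.comp_hasDerivWithinAt τ (hγ τ hτ)
      have hmem : ∀ τ ∈ Icc 0 s, β τ ∈ galerkinSubspace S := fun τ _ => (γ τ).2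
      -- the energy `ψ = ∑ ‖β k‖²` is non-increasing
      set ψ : ℝ → ℝ := fun τ => ∑ k, (1 : ℝ) * ‖β τ k‖ ^ 2 with hψ
      set ψ' : ℝ → ℝ := fun τ => ∑ k : ↥S, (1 : ℝ) * (2 * (inner ℂ (β τ k) (W (β τ) k)).re) with hψ'
      have hderiv : ∀ τ ∈ Icc 0 s, HasDerivWithinAt ψ (ψ' τ) (Icc 0 s) τ := fun τ hτ =>
        hasDerivWithinAt_weightedEnergy (hβ' τ hτ) (fun _ => (1 : ℝ))
      have hψc : ContinuousOn ψ (Icc 0 s) := fun τ hτ => (hderiv τ hτ).continuousWithinAt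
      have hbound : ∀ τ ∈ Ico 0 s, ψ' τ ≤ 0 * ψ τ + 0 := by
        intro τ hτ
        rw [zero_mul, add_zero]
        exact energyPairing_le hS hν hσ (hmem τ (Ico_subset_Icc_self hτ))
      have hgron := le_gronwallBound_of_liminf_deriv_right_le (f := ψ) (f' := ψ') (δ := ψ 0) (K := 0)
        (ε := 0) (a := 0) (b := s) hψc
        (fun τ hτ r hr => (hasDerivWithinAt_Ici_of_Icc hτ (hderiv τ (Ico_subset_Icc_self hτ))).liminf_right_slope_le hr)
        le_rfl hbound t ht
      simp only [gronwallBound_K0, zero_mul, add_zero] at hgron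
      have hb : ∑ k, ‖β t k‖ ^ 2 ≤ ∑ k, ‖β 0 k‖ ^ 2 := by simpa [hψ] using hgron
      have hβ0 : β 0 = c₀ := by simp [hβ, hγ0]
      rw [hβ0] at hb
      change ‖β t‖ ≤ _
      exact (norm_le_sqrt_sum_norm_sq (β t)).trans (Real.sqrt_le_sqrt hb)
  obtain ⟨γ, hγ0, hγ⟩ := ODE.exists_solution_of_apriori_bound hlip hcont hapriori
  -- continuity of `γ` on `[0, ∞)`
  have hγc : ContinuousOn (fun t => (γ t : ↥S → EuclideanSpace ℂ d)) (Ici 0) := by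
    intro t ht
    have hc := IsIntegralCurveOn.continuousOn (hγ (t + 1)) t ⟨ht, by linarith⟩
    have hmem : Icc 0 (t + 1) ∈ 𝓝[Ici 0] t :=
      Filter.mem_of_superset (inter_mem_nhdsWithin (Ici (0 : ℝ)) (Iio_mem_nhds (by linarith)))
        fun s hs => ⟨hs.1, hs.2.le⟩
    exact (continuous_subtype_val.continuousAt.comp_continuousWithinAt hc).mono_of_mem_nhdsWithin hmem
  -- freeze at the initial value for negative times
  refine ⟨fun t => (γ (max t 0) : ↥S → EuclideanSpace ℂ d), by simp [hγ0], fun t => (γ _).2, ?_, ?_⟩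
  · have h1 : Continuous fun t : ℝ => (⟨max t 0, le_max_right t 0⟩ : Ici (0 : ℝ)) :=
      (continuous_id.max continuous_const).subtype_mk _
    exact (continuousOn_iff_continuous_restrict.1 hγc).comp h1
  · intro T t ht
    have h := Y.subtypeL.hasFDerivAt.comp_hasDerivWithinAt t (hγ T t ht)
    have ht0 : max t 0 = t := max_eq_left ht.1
    refine (h.congr (fun τ hτ => ?_) ?_).congr_deriv ?_
    · simp [max_eq_left hτ.1]
    · simp [ht0]
    · simp only [ht0]
      rfl

end Existence

end GalerkinSmooth

end Literature.Analysis.FluidPDE
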